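import Literature.Analysis.FluidPDE.FractionalNSStartingTriple
import Mathlib.Analysis.MeanInequalitiesPow
import HarnessLib

/-!
# Colombo–De Lellis–De Rosa 2018, Lemma 3.1: the estimates of the starting triple

Analysis/FluidPDE file, sequel of `FractionalNSStartingTriple` (which defines the shear-flow
triple `(v₀, p₀, R̊₀) = (g P_n, 0, coef S_n)` of Lemma 3.1 of Colombo–De Lellis–De Rosa,
Comm. Math. Phys. 362 (2018) = arXiv:1708.05666, §3.1, and proves that it solves the fractional
Navier–Stokes–Reynolds system). Here we carry out the second half of the printed proof
(pp. 6–7, "Proof of (31)", "Proof of (32)", "Proof of (33)", "Conclusion", with the conditions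
(38)–(51)): the choice of the frequency `λ̄` and the verification of the stage-`0` estimates of the
iteration Prop. 3.2 in terms of the parameters `δ_q = a^{-b^q}`, `λ₀ ≥ a^{cb}`:

"Fix `M` and `η` positive constants and let `α ∈ ]0,1/5[`. If `a, b` and `c` satisfy
`c > 5/2`, `b > 1`, `a^{(c-1)b-1/2} ≥ C₀‖e‖_{C¹}` and `a^{(2c-1)b-1} ≥ C₀‖e‖_{C²}` (where `C₀` is
a suitable geometric constant, depending only upon `M` and `η`), then there is a triple
`(v₀, p₀, R̊₀)` satisfying (26), (31) `‖R̊₀‖₀ ≤ ηδ₁`, (32) `‖R̊₀‖₁ ≤ Mδ₁λ₀`,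
(33) `‖∂ₜR̊₀ + v₀·∇R̊₀‖₀ ≤ δ₁δ₀^{1/2}λ₀` and (37) `‖v₀‖₀ ≤ M`,
(38) `‖v₀‖₁ ≤ min{C₀ max{a^{b/(1-2α)}, a^b‖e‖_{C¹}, ‖e‖_{C²}^{(cb-1/2)/((2c-1)b-1)}}, Mδ₀^{1/2}λ₀}`,
(39) `‖p₀‖₀ ≤ M²`, (40) `‖p₀‖₁ ≤ M²δ₀λ₀²`."

We prove this in the tree's normalisation and in the universal form used in §8.3 of the source
((81)–(82): `‖e‖_{C¹}`, `‖e‖_{C²}` replaced by the family bounds `E₁`, `E₂` of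
`IsEnergyProfileFamily c₀ T₀ E₁ E₂`, and `λ̄` chosen BEFORE the profile), as the theorem
`ColomboDeLellisDeRosa2018_lem31` (hypotheses bundled as `CDLDR.StartHyp` — constants and
parameters — and `CDLDR.StartProfile` — one profile; `IsEnergyProfileFamily.startProfile` feeds
the members of an admissible family): the frequency is `n = ⌈λ̄⌉` with
`λ̄ = K (a^{b/(1-2α)} + a^bE₁ + E₂a^{-((c-1)b-1/2)})` (`CDLDR.startFreq`; the printed (82) has a
`max` instead of the sum, which changes constants only), the constants
`K = CDLDR.startFreqConst`, `C₀ = CDLDR.startDerivConst`, `a₀ = CDLDR.startThreshold` are explicit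
in `α, c₀, T₀, M, η` (independent of `b, c, e, E₁, E₂`), and the conclusions are (26), (31), (32),
(33), (37), both halves of (38) (as `[·]₁`-bounds, `BDSV.DerivSupLE`), the exact energy identity
`∫‖v₀(t)‖² = (1-δ₁)e(t)` (so (35) holds at `q = 0`) and `p₀ = 0` ((39)–(40) are then empty).
The hypotheses on `a` are those of Prop. 3.2 (41)/(81): `a ≥ a₀`, `a ≥ C₀E₁`,
`a ≥ C₀E₂^{1/((2c-1)b-1)}` (stronger than (36), as noted in §8.2), for ANY `c ≥ 5/2`, `b ≥ 1`.

## References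

* M. Colombo, C. De Lellis, L. De Rosa, Comm. Math. Phys. 362 (2018) = arXiv:1708.05666, §3.1
  Lemma 3.1 with (36)–(51) (pp. 6–7); §3.2 Prop. 3.2 (41); §8.3 (81)–(82) (p. 19).
  [`ColomboDelellisDerosa2018`]
-/

noncomputable section

open MeasureTheory Set Filter Function UnitAddTorus
open scoped ENNReal NNReal InnerProductSpace ContDiff

namespace Literature.Analysis.FluidPDE

namespace CDLDR

open FunctionSpaces PulsedShear

/-- The flat three-torus `𝕋³ = (ℝ/ℤ)³`, local notation. -/
local notation "𝕋³" => UnitAddTorus (Fin 3)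

/-- Euclidean `ℝ³`, local notation. -/
local notation "ℝ³" => EuclideanSpace ℝ (Fin 3)

/-! ## Elementary inequalities for real powers -/

section Rpow

/-- Subadditivity of concave powers on `ℝ`: `(x + y)^p ≤ x^p + y^p` for `x, y ≥ 0`, `0 ≤ p ≤ 1`
(Mathlib's `NNReal.rpow_add_le_add_rpow`, transported). [folklore] -/
theorem rpow_add_le_add_rpow_real {x y p : ℝ} (hx : 0 ≤ x) (hy : 0 ≤ y) (hp : 0 ≤ p) (hp1 : p ≤ 1) :
    (x + y) ^ p ≤ x ^ p + y ^ p := by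
  lift x to ℝ≥0 using hx
  lift y to ℝ≥0 using hy
  exact_mod_cast NNReal.rpow_add_le_add_rpow x y hp hp1

/-- `a^θ ≥ 1` and monotonicity in the exponent for `a ≥ 1`: `1 ≤ a`, `θ₁ ≤ θ₂` give
`a^θ₁ ≤ a^θ₂`. [folklore] -/
theorem rpow_le_rpow_exp {a θ₁ θ₂ : ℝ} (ha : 1 ≤ a) (h : θ₁ ≤ θ₂) : a ^ θ₁ ≤ a ^ θ₂ :=
  Real.rpow_le_rpow_of_exponent_le ha h

/-- From `Q ≤ a^{1/3}` (`a ≥ 1`) to `Q ≤ a^θ` for every `θ ≥ 1/3`. [folklore] -/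
theorem le_rpow_of_le_rpow_third {a Q θ : ℝ} (ha : 1 ≤ a) (hQ : Q ≤ a ^ (1 / 3 : ℝ)) (hθ : 1 / 3 ≤ θ) :
    Q ≤ a ^ θ :=
  hQ.trans (rpow_le_rpow_exp ha hθ)

/-- `Q ≤ a^{1/3}` when `Q ≥ 0` and `Q³ ≤ a`. [folklore] -/
theorem le_rpow_third_of_pow_le {a Q : ℝ} (hQ : 0 ≤ Q) (h : Q ^ 3 ≤ a) : Q ≤ a ^ (1 / 3 : ℝ) := by
  have ha : 0 ≤ a := (pow_nonneg hQ 3).trans h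
  calc Q = (Q ^ 3) ^ (1 / 3 : ℝ) := by
        rw [← Real.rpow_natCast, ← Real.rpow_mul hQ]
        norm_num
    _ ≤ a ^ (1 / 3 : ℝ) := Real.rpow_le_rpow (pow_nonneg hQ 3) h (by norm_num)

end Rpow

/-! ## The constants and the frequency of the starting triple -/

section Constants

/-- The constant `K = K(α,c₀,T₀,η) ≥ 1` multiplying the frequency `λ̄` of the starting triple
(the tree version of the `C₀` in (82) `λ̄ = C₀ max{a^{b/(1-2α)}, E₁a^b, E₂a^{-(c-1)b+1/2}}`):
`K = 1 + √2√c₀/(πT₀η) + 2√2√c₀/(πT₀²) + (2√2√c₀/η + 1)^{1/(1-2α)}`.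
[cite: ColomboDelellisDerosa2018, §3.1 (45)/(47) and §8.3 (82)] -/
def startFreqConst (α c₀ T₀ η : ℝ) : ℝ :=
  1 + Real.sqrt 2 * Real.sqrt c₀ / (Real.pi * T₀ * η) + 2 * Real.sqrt 2 * Real.sqrt c₀ / (Real.pi * T₀ ^ 2) +
    (2 * Real.sqrt 2 * Real.sqrt c₀ / η + 1) ^ (1 / (1 - 2 * α))

/-- The constant `C₀ = C₀(α,c₀,T₀,M,η) ≥ 1` of Lemma 3.1 in the tree's rendering (it bounds
`[v₀]₁` in (38) and enters the hypotheses `a ≥ C₀E₁`, `a ≥ C₀E₂^{1/((2c-1)b-1)}`):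
`C₀ = 1 + 2√2√c₀/(T₀M) + 4√2√c₀/(πT₀²) + 2√2√c₀/T₀ + 12√2π√c₀K + 12√2π√c₀K/M`.
[cite: ColomboDelellisDerosa2018, §3.1 Lemma 3.1 ("`C₀` is a suitable geometric constant, depending only upon `M` and `η`")] -/
def startDerivConst (α c₀ T₀ M η : ℝ) : ℝ :=
  1 + 2 * Real.sqrt 2 * Real.sqrt c₀ / (T₀ * M) + 4 * Real.sqrt 2 * Real.sqrt c₀ / (Real.pi * T₀ ^ 2) +
    2 * Real.sqrt 2 * Real.sqrt c₀ / T₀ + 12 * Real.sqrt 2 * Real.pi * Real.sqrt c₀ * startFreqConst α c₀ T₀ η +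
    12 * Real.sqrt 2 * Real.pi * Real.sqrt c₀ * startFreqConst α c₀ T₀ η / M

/-- The threshold `a₀ = 2 + Q³`, `Q = 1 + 24√2π√c₀K/M`, for the parameter `a` (the tree version
of "`a` sufficiently large", i.e. of `a₀(b,c)` in Prop. 3.2 (41); here independent of `b, c`).
[cite: ColomboDelellisDerosa2018, §3.2 Prop. 3.2 (41)] -/
def startThreshold (α c₀ T₀ M η : ℝ) : ℝ :=
  2 + (1 + 24 * Real.sqrt 2 * Real.pi * Real.sqrt c₀ * startFreqConst α c₀ T₀ η / M) ^ 3

/-- The real frequency `λ̄ = K (a^{b/(1-2α)} + a^bE₁ + E₂a^{-((c-1)b-1/2)})` (the printed (82)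
with the `max` replaced by a sum). [cite: ColomboDelellisDerosa2018, §8.3 (82)] -/
def startFreqReal (α c₀ T₀ η a b c E₁ E₂ : ℝ) : ℝ :=
  startFreqConst α c₀ T₀ η * (a ^ (b / (1 - 2 * α)) + a ^ b * E₁ + E₂ * a ^ (-((c - 1) * b - 1 / 2)))

/-- The integer frequency `n = ⌈λ̄⌉` of the starting triple ("`λ̄` is an integer whose choice
will be specified later"). [cite: ColomboDelellisDerosa2018, §3.1 (proof of Lemma 3.1) and §8.3 (82)] -/
def startFreq (α c₀ T₀ η a b c E₁ E₂ : ℝ) : ℕ :=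
  ⌈startFreqReal α c₀ T₀ η a b c E₁ E₂⌉₊

variable {α c₀ T₀ M η a b c E₁ E₂ : ℝ}

/-- `K ≥ 1`. [folklore] -/
theorem one_le_startFreqConst (hT₀ : 0 < T₀) (hη : 0 < η) : 1 ≤ startFreqConst α c₀ T₀ η := by
  unfold startFreqConst
  have h1 : 0 ≤ Real.sqrt 2 * Real.sqrt c₀ / (Real.pi * T₀ * η) := by positivity
  have h2 : 0 ≤ 2 * Real.sqrt 2 * Real.sqrt c₀ / (Real.pi * T₀ ^ 2) := by positivity
  have h3 : 0 ≤ (2 * Real.sqrt 2 * Real.sqrt c₀ / η + 1) ^ (1 / (1 - 2 * α)) := by positivity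
  linarith

/-- `K ≥ √2√c₀/(πT₀η)` (used for `‖R̊₀,₁‖₀ ≤ ηδ₁/2`). [folklore] -/
theorem startFreqConst_ge₁ (hT₀ : 0 < T₀) (hη : 0 < η) :
    Real.sqrt 2 * Real.sqrt c₀ / (Real.pi * T₀ * η) ≤ startFreqConst α c₀ T₀ η := by
  unfold startFreqConst
  have h2 : 0 ≤ 2 * Real.sqrt 2 * Real.sqrt c₀ / (Real.pi * T₀ ^ 2) := by positivity
  have h3 : 0 ≤ (2 * Real.sqrt 2 * Real.sqrt c₀ / η + 1) ^ (1 / (1 - 2 * α)) := by positivity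
  linarith

/-- `K ≥ 2√2√c₀/(πT₀²)` (used for `‖∂ₜR̊₀,₁‖₀`). [folklore] -/
theorem startFreqConst_ge₂ (hT₀ : 0 < T₀) (hη : 0 < η) :
    2 * Real.sqrt 2 * Real.sqrt c₀ / (Real.pi * T₀ ^ 2) ≤ startFreqConst α c₀ T₀ η := by
  unfold startFreqConst
  have h1 : 0 ≤ Real.sqrt 2 * Real.sqrt c₀ / (Real.pi * T₀ * η) := by positivity
  have h3 : 0 ≤ (2 * Real.sqrt 2 * Real.sqrt c₀ / η + 1) ^ (1 / (1 - 2 * α)) := by positivity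
  linarith

/-- `K^{1-2α} ≥ 2√2√c₀/η` (used for `‖R̊₀,₂‖₀ ≤ ηδ₁/2`), for `α < 1/2`. [folklore] -/
theorem startFreqConst_rpow_ge (hα : α < 1 / 2) (hT₀ : 0 < T₀) (hη : 0 < η) :
    2 * Real.sqrt 2 * Real.sqrt c₀ / η ≤ startFreqConst α c₀ T₀ η ^ (1 - 2 * α) := by
  have hpos : 0 < 1 - 2 * α := by linarith
  have hK4 : (2 * Real.sqrt 2 * Real.sqrt c₀ / η + 1) ^ (1 / (1 - 2 * α)) ≤ startFreqConst α c₀ T₀ η := by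
    unfold startFreqConst
    have h1 : 0 ≤ Real.sqrt 2 * Real.sqrt c₀ / (Real.pi * T₀ * η) := by positivity
    have h2 : 0 ≤ 2 * Real.sqrt 2 * Real.sqrt c₀ / (Real.pi * T₀ ^ 2) := by positivity
    linarith
  have h0 : 0 ≤ 2 * Real.sqrt 2 * Real.sqrt c₀ / η + 1 := by positivity
  calc 2 * Real.sqrt 2 * Real.sqrt c₀ / η ≤ 2 * Real.sqrt 2 * Real.sqrt c₀ / η + 1 := by linarith
    _ = ((2 * Real.sqrt 2 * Real.sqrt c₀ / η + 1) ^ (1 / (1 - 2 * α))) ^ (1 - 2 * α) := by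
        rw [← Real.rpow_mul h0, one_div_mul_cancel hpos.ne', Real.rpow_one]
    _ ≤ startFreqConst α c₀ T₀ η ^ (1 - 2 * α) := Real.rpow_le_rpow (by positivity) hK4 hpos.le

/-- `C₀ ≥ 1`. [folklore] -/
theorem one_le_startDerivConst (hT₀ : 0 < T₀) (hM : 0 < M) (hη : 0 < η) :
    1 ≤ startDerivConst α c₀ T₀ M η := by
  unfold startDerivConst
  have hK : 0 ≤ startFreqConst α c₀ T₀ η := zero_le_one.trans (one_le_startFreqConst hT₀ hη)
  have h1 : 0 ≤ 2 * Real.sqrt 2 * Real.sqrt c₀ / (T₀ * M) := by positivity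
  have h2 : 0 ≤ 4 * Real.sqrt 2 * Real.sqrt c₀ / (Real.pi * T₀ ^ 2) := by positivity
  have h3 : 0 ≤ 2 * Real.sqrt 2 * Real.sqrt c₀ / T₀ := by positivity
  have h4 : 0 ≤ 12 * Real.sqrt 2 * Real.pi * Real.sqrt c₀ * startFreqConst α c₀ T₀ η := by positivity
  have h5 : 0 ≤ 12 * Real.sqrt 2 * Real.pi * Real.sqrt c₀ * startFreqConst α c₀ T₀ η / M := by positivity
  linarith

/-- The five lower bounds on `C₀` used in the proof. [folklore] -/
theorem startDerivConst_ge (hT₀ : 0 < T₀) (hM : 0 < M) (hη : 0 < η) :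
    2 * Real.sqrt 2 * Real.sqrt c₀ / (T₀ * M) ≤ startDerivConst α c₀ T₀ M η ∧
    4 * Real.sqrt 2 * Real.sqrt c₀ / (Real.pi * T₀ ^ 2) ≤ startDerivConst α c₀ T₀ M η ∧
    2 * Real.sqrt 2 * Real.sqrt c₀ / T₀ ≤ startDerivConst α c₀ T₀ M η ∧
    12 * Real.sqrt 2 * Real.pi * Real.sqrt c₀ * startFreqConst α c₀ T₀ η ≤ startDerivConst α c₀ T₀ M η ∧
    12 * Real.sqrt 2 * Real.pi * Real.sqrt c₀ * startFreqConst α c₀ T₀ η / M ≤ startDerivConst α c₀ T₀ M η := by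
  unfold startDerivConst
  have hK : 0 ≤ startFreqConst α c₀ T₀ η := zero_le_one.trans (one_le_startFreqConst hT₀ hη)
  have h1 : 0 ≤ 2 * Real.sqrt 2 * Real.sqrt c₀ / (T₀ * M) := by positivity
  have h2 : 0 ≤ 4 * Real.sqrt 2 * Real.sqrt c₀ / (Real.pi * T₀ ^ 2) := by positivity
  have h3 : 0 ≤ 2 * Real.sqrt 2 * Real.sqrt c₀ / T₀ := by positivity
  have h4 : 0 ≤ 12 * Real.sqrt 2 * Real.pi * Real.sqrt c₀ * startFreqConst α c₀ T₀ η := by positivity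
  have h5 : 0 ≤ 12 * Real.sqrt 2 * Real.pi * Real.sqrt c₀ * startFreqConst α c₀ T₀ η / M := by positivity
  refine ⟨by linarith, by linarith, by linarith, by linarith, by linarith⟩

/-- `a₀ ≥ 2`, and `a ≥ a₀` gives `Q ≤ a^{1/3}` for `Q = 1 + 24√2π√c₀K/M`. [folklore] -/
theorem startThreshold_spec (hT₀ : 0 < T₀) (hM : 0 < M) (hη : 0 < η) (ha : startThreshold α c₀ T₀ M η ≤ a) :
    2 ≤ a ∧ 1 + 24 * Real.sqrt 2 * Real.pi * Real.sqrt c₀ * startFreqConst α c₀ T₀ η / M ≤ a ^ (1 / 3 : ℝ) := by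
  unfold startThreshold at ha
  have hK : 0 ≤ startFreqConst α c₀ T₀ η := zero_le_one.trans (one_le_startFreqConst hT₀ hη)
  have hQ : 0 ≤ 1 + 24 * Real.sqrt 2 * Real.pi * Real.sqrt c₀ * startFreqConst α c₀ T₀ η / M := by positivity
  have hQ3 := pow_nonneg hQ 3
  exact ⟨by linarith, le_rpow_third_of_pow_le hQ (by linarith)⟩

end Constants

/-! ## Consequences of the hypotheses on `a` -/

section Parameters

variable {α a b c C₀ E₁ E₂ K : ℝ}

/-- From `C₀ E₂^{1/((2c-1)b-1)} ≤ a` (`C₀ ≥ 1`, `E₂ ≥ 0`, `(2c-1)b - 1 ≥ 1`):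
`E₂ ≤ a^{(2c-1)b-1}` and `C₀E₂ ≤ a^{(2c-1)b-1}` (the form (36) of the hypothesis, cf. §8.2:
"since `(c-1)b - 1/2 > 1`, (41) is stronger than (36)"). [cite: ColomboDelellisDerosa2018, §8.2 (first paragraph)] -/
theorem E₂_le_rpow (hC₀ : 1 ≤ C₀) (hE₂ : 0 ≤ E₂) (hr : 1 ≤ (2 * c - 1) * b - 1)
    (h : C₀ * E₂ ^ (1 / ((2 * c - 1) * b - 1)) ≤ a) :
    E₂ ≤ a ^ ((2 * c - 1) * b - 1) ∧ C₀ * E₂ ≤ a ^ ((2 * c - 1) * b - 1) := by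
  set r : ℝ := (2 * c - 1) * b - 1 with hr_def
  have hr0 : 0 < r := by linarith
  have hs0 : 0 ≤ E₂ ^ (1 / r) := Real.rpow_nonneg hE₂ _
  have h0 : 0 ≤ C₀ * E₂ ^ (1 / r) := mul_nonneg (by linarith) hs0
  have ha : 0 ≤ a := h0.trans h
  have hpow : (E₂ ^ (1 / r)) ^ r = E₂ := by
    rw [← Real.rpow_mul hE₂, one_div_mul_cancel hr0.ne', Real.rpow_one]
  have h2 : (C₀ * E₂ ^ (1 / r)) ^ r ≤ a ^ r := Real.rpow_le_rpow h0 h hr0.le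
  rw [Real.mul_rpow (by linarith) hs0, hpow] at h2
  have hC₀r : C₀ ≤ C₀ ^ r := Real.self_le_rpow_of_one_le hC₀ hr
  have h3 : C₀ * E₂ ≤ C₀ ^ r * E₂ := mul_le_mul_of_nonneg_right hC₀r hE₂
  have h4 : E₂ ≤ C₀ * E₂ := le_mul_of_one_le_left hE₂ hC₀
  exact ⟨h4.trans (h3.trans h2), h3.trans h2⟩

/-- The third term of the frequency is controlled by `a`: with `C₀E₂ ≤ a^{(2c-1)b-1}`,
`E₂ a^{-((c-1)b-1/2)} ≤ a^{cb-1/2}/C₀` (the step "(e:otto)" at the end of the proof of Lemma 3.1).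
[cite: ColomboDelellisDerosa2018, §3.1 (proof of Lemma 3.1, (50)–(51))] -/
theorem E₂_mul_rpow_neg_le (ha : 0 < a) (hC₀ : 0 < C₀) (h : C₀ * E₂ ≤ a ^ ((2 * c - 1) * b - 1)) :
    E₂ * a ^ (-((c - 1) * b - 1 / 2)) ≤ a ^ (c * b - 1 / 2) / C₀ := by
  rw [le_div_iff₀ hC₀, Real.rpow_neg ha.le]
  have hq : 0 < a ^ ((c - 1) * b - 1 / 2) := Real.rpow_pos_of_pos ha _
  rw [mul_comm, ← mul_assoc, ← div_eq_mul_inv, div_le_iff₀ hq, ← Real.rpow_add ha]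
  have : c * b - 1 / 2 + ((c - 1) * b - 1 / 2) = (2 * c - 1) * b - 1 := by ring
  rw [this]
  exact h

/-- The third term of the frequency is controlled by `E₂`: with `E₂ ≤ a^{(2c-1)b-1}` (`E₂ > 0`,
`a ≥ 1`),
`E₂ a^{-((c-1)b-1/2)} ≤ E₂^{(cb-1/2)/((2c-1)b-1)}` (the bound on `λ̄` in the "Conclusion" of the
proof of Lemma 3.1, giving (38); here for `c ≥ 3/2`, `b ≥ 1`). [cite: ColomboDelellisDerosa2018, §3.1 (proof of Lemma 3.1, "Conclusion", (47))] -/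
theorem E₂_mul_rpow_neg_le_rpow (ha : 1 ≤ a) (hE₂ : 0 < E₂) (hb : 1 ≤ b) (hc : 3 / 2 ≤ c)
    (h : E₂ ≤ a ^ ((2 * c - 1) * b - 1)) :
    E₂ * a ^ (-((c - 1) * b - 1 / 2)) ≤ E₂ ^ ((c * b - 1 / 2) / ((2 * c - 1) * b - 1)) := by
  set r : ℝ := (2 * c - 1) * b - 1 with hr_def
  set q : ℝ := (c - 1) * b - 1 / 2 with hq_def
  have hr0 : 0 < r := by
    rw [hr_def]; nlinarith [mul_nonneg (by linarith : (0:ℝ) ≤ 2 * c - 3) (by linarith : (0:ℝ) ≤ b)]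
  have hq0 : 0 ≤ q := by
    rw [hq_def]; nlinarith [mul_nonneg (by linarith : (0:ℝ) ≤ c - 3 / 2) (by linarith : (0:ℝ) ≤ b)]
  have ha0 : 0 < a := by linarith
  -- `E₂^{q/r} ≤ a^q`
  have h1 : E₂ ^ (q / r) ≤ a ^ q := by
    calc E₂ ^ (q / r) ≤ (a ^ r) ^ (q / r) := Real.rpow_le_rpow hE₂.le h (div_nonneg hq0 hr0.le)
      _ = a ^ q := by rw [← Real.rpow_mul ha0.le, mul_div_cancel₀ q hr0.ne']
  -- invert
  have h2 : a ^ (-q) ≤ E₂ ^ (-(q / r)) := by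
    rw [Real.rpow_neg ha0.le, Real.rpow_neg hE₂.le]
    exact inv_anti₀ (Real.rpow_pos_of_pos hE₂ _) h1
  calc E₂ * a ^ (-q) ≤ E₂ * E₂ ^ (-(q / r)) := mul_le_mul_of_nonneg_left h2 hE₂.le
    _ = E₂ ^ (1 + -(q / r)) := by rw [Real.rpow_add hE₂, Real.rpow_one]
    _ = E₂ ^ ((c * b - 1 / 2) / ((2 * c - 1) * b - 1)) := by
        congr 1
        rw [← hr_def]
        field_simp
        rw [hq_def, hr_def]
        ring

end Parameters

/-! ## The frequency `n = ⌈λ̄⌉` -/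

section Frequency

variable {α c₀ T₀ η a b c E₁ E₂ : ℝ}

/-- The three terms of `λ̄/K` are non-negative and the first is at least `1` (`a ≥ 1`,
`α < 1/2`, `b ≥ 0`, `E₁, E₂ ≥ 0`). [folklore] -/
theorem startFreq_terms (hα : α < 1 / 2) (ha : 1 ≤ a) (hb : 0 ≤ b) (hE₁ : 0 ≤ E₁) (hE₂ : 0 ≤ E₂) :
    1 ≤ a ^ (b / (1 - 2 * α)) ∧ 0 ≤ a ^ b * E₁ ∧ 0 ≤ E₂ * a ^ (-((c - 1) * b - 1 / 2)) := by
  have ha0 : 0 ≤ a := by linarith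
  refine ⟨Real.one_le_rpow ha (div_nonneg hb (by linarith)), mul_nonneg (Real.rpow_nonneg ha0 _) hE₁,
    mul_nonneg hE₂ (Real.rpow_nonneg ha0 _)⟩

/-- `λ̄ ≥ K ≥ 1`. [folklore] -/
theorem startFreqConst_le_startFreqReal (hα : α < 1 / 2) (hT₀ : 0 < T₀) (hη : 0 < η) (ha : 1 ≤ a)
    (hb : 0 ≤ b) (hE₁ : 0 ≤ E₁) (hE₂ : 0 ≤ E₂) :
    startFreqConst α c₀ T₀ η ≤ startFreqReal α c₀ T₀ η a b c E₁ E₂ := by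
  obtain ⟨hX, hY, hZ⟩ := startFreq_terms (c := c) hα ha hb hE₁ hE₂
  have hK : 0 ≤ startFreqConst α c₀ T₀ η := zero_le_one.trans (one_le_startFreqConst hT₀ hη)
  unfold startFreqReal
  nlinarith

/-- The integer frequency dominates the real one: `λ̄ ≤ n`. [folklore] -/
theorem startFreqReal_le_startFreq : startFreqReal α c₀ T₀ η a b c E₁ E₂ ≤ startFreq α c₀ T₀ η a b c E₁ E₂ :=
  Nat.le_ceil _

/-- `n ≤ λ̄ + 1 ≤ 2λ̄`. [folklore] -/
theorem startFreq_le_two_mul (hα : α < 1 / 2) (hT₀ : 0 < T₀) (hη : 0 < η) (ha : 1 ≤ a)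
    (hb : 0 ≤ b) (hE₁ : 0 ≤ E₁) (hE₂ : 0 ≤ E₂) :
    (startFreq α c₀ T₀ η a b c E₁ E₂ : ℝ) ≤ 2 * startFreqReal α c₀ T₀ η a b c E₁ E₂ := by
  have hL : 1 ≤ startFreqReal α c₀ T₀ η a b c E₁ E₂ :=
    (one_le_startFreqConst hT₀ hη).trans (startFreqConst_le_startFreqReal hα hT₀ hη ha hb hE₁ hE₂)
  have h := Nat.ceil_lt_add_one (zero_le_one.trans hL)
  unfold startFreq
  linarith

/-- `n ≥ 1`. [folklore] -/
theorem one_le_startFreq (hα : α < 1 / 2) (hT₀ : 0 < T₀) (hη : 0 < η) (ha : 1 ≤ a)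
    (hb : 0 ≤ b) (hE₁ : 0 ≤ E₁) (hE₂ : 0 ≤ E₂) : 1 ≤ startFreq α c₀ T₀ η a b c E₁ E₂ := by
  have hL : (1 : ℝ) ≤ startFreqReal α c₀ T₀ η a b c E₁ E₂ :=
    (one_le_startFreqConst hT₀ hη).trans (startFreqConst_le_startFreqReal hα hT₀ hη ha hb hE₁ hE₂)
  have h : (1 : ℝ) ≤ startFreq α c₀ T₀ η a b c E₁ E₂ := hL.trans startFreqReal_le_startFreq
  exact_mod_cast h

/-- The three lower bounds `n ≥ K a^{b/(1-2α)}`, `n ≥ K a^b E₁`, `n ≥ K E₂ a^{-((c-1)b-1/2)}`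
((45)–(47): `λ̄` is at least each of the three right-hand sides). [cite: ColomboDelellisDerosa2018, §3.1 (proof of Lemma 3.1, (45)–(47))] -/
theorem startFreq_ge (hα : α < 1 / 2) (hT₀ : 0 < T₀) (hη : 0 < η) (ha : 1 ≤ a) (hb : 0 ≤ b)
    (hE₁ : 0 ≤ E₁) (hE₂ : 0 ≤ E₂) :
    startFreqConst α c₀ T₀ η * a ^ (b / (1 - 2 * α)) ≤ startFreq α c₀ T₀ η a b c E₁ E₂ ∧
    startFreqConst α c₀ T₀ η * (a ^ b * E₁) ≤ startFreq α c₀ T₀ η a b c E₁ E₂ ∧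
    startFreqConst α c₀ T₀ η * (E₂ * a ^ (-((c - 1) * b - 1 / 2))) ≤ startFreq α c₀ T₀ η a b c E₁ E₂ := by
  obtain ⟨hX, hY, hZ⟩ := startFreq_terms (c := c) hα ha hb hE₁ hE₂
  have hK : 0 ≤ startFreqConst α c₀ T₀ η := zero_le_one.trans (one_le_startFreqConst hT₀ hη)
  have hn := (startFreqReal_le_startFreq (α := α) (c₀ := c₀) (T₀ := T₀) (η := η) (a := a) (b := b) (c := c)
    (E₁ := E₁) (E₂ := E₂))
  unfold startFreqReal at hn
  refine ⟨?_, ?_, ?_⟩ <;> nlinarith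

end Frequency

/-! ## The inequalities of the proof of Lemma 3.1 (real arithmetic) -/

section Algebra

variable {α a b c G K C₀ M η T₀ E₁ E₂ n lam₀ : ℝ}

/-- `(2πn)^{2α-1} ≤ K^{2α-1} a^{-b}` when `n ≥ K a^{b/(1-2α)} > 0` and `α < 1/2`
(the frequency condition (45)/(39): `λ̄ ≥ C₀δ₁^{-1/(1-2α)}`). [cite: ColomboDelellisDerosa2018, §3.1 (proof of Lemma 3.1, (39))] -/
theorem rpow_freq_le (hα : α < 1 / 2) (ha : 1 ≤ a) (hK : 1 ≤ K) (hnX : K * a ^ (b / (1 - 2 * α)) ≤ n) :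
    (2 * Real.pi * n) ^ (2 * α - 1) ≤ K ^ (2 * α - 1) * a ^ (-b) := by
  have ha0 : 0 < a := by linarith
  have hK0 : 0 < K := by linarith
  have hX : 0 < a ^ (b / (1 - 2 * α)) := Real.rpow_pos_of_pos ha0 _
  have hKX : 0 < K * a ^ (b / (1 - 2 * α)) := mul_pos hK0 hX
  have hn : 0 < n := lt_of_lt_of_le hKX hnX
  have h2πn : K * a ^ (b / (1 - 2 * α)) ≤ 2 * Real.pi * n := by
    calc K * a ^ (b / (1 - 2 * α)) ≤ n := hnX
      _ = 1 * n := (one_mul n).symm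
      _ ≤ 2 * Real.pi * n := by
          refine mul_le_mul_of_nonneg_right ?_ hn.le
          linarith [Real.pi_gt_three]
  have h1 : (2 * Real.pi * n) ^ (2 * α - 1) ≤ (K * a ^ (b / (1 - 2 * α))) ^ (2 * α - 1) :=
    Real.rpow_le_rpow_of_nonpos hKX h2πn (by linarith)
  refine h1.trans (le_of_eq ?_)
  rw [Real.mul_rpow hK0.le hX.le, ← Real.rpow_mul ha0.le]
  congr 2
  have : (1 - 2 * α) ≠ 0 := by linarith
  field_simp
  ring

/-- `K^{2α-1} ≤ η/(2√2 G)` when `K^{1-2α} ≥ 2√2G/η` (`G, η > 0`). [folklore] -/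
theorem rpow_const_le (hG : 0 < G) (hη : 0 < η) (hK : 0 < K)
    (hK₄ : 2 * Real.sqrt 2 * G / η ≤ K ^ (1 - 2 * α)) :
    K ^ (2 * α - 1) ≤ η / (2 * Real.sqrt 2 * G) := by
  have h1 : K ^ (2 * α - 1) = (K ^ (1 - 2 * α))⁻¹ := by
    rw [← Real.rpow_neg hK.le]; congr 1; ring
  rw [h1, ← one_div, div_le_div_iff₀ (Real.rpow_pos_of_pos hK _) (by positivity), one_mul]
  rw [div_le_iff₀ hη] at hK₄
  linarith

/-- `K^{2α-1} ≤ 1` for `K ≥ 1`, `α ≤ 1/2`. [folklore] -/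
theorem rpow_const_le_one (hK : 1 ≤ K) (hα : α ≤ 1 / 2) : K ^ (2 * α - 1) ≤ 1 :=
  Real.rpow_le_one_of_one_le_of_nonpos hK (by linarith)

/-- **(31): `‖R̊₀‖₀ ≤ ηδ₁`** in real-arithmetic form:
`√2 (GE₁/T₀/(2πn) + (2πn)^{2α-1} G) ≤ η a^{-b}` under the frequency conditions
`n ≥ K a^bE₁` ((38): "`λ̄ ≥ C₀‖e‖_{C¹}δ₁⁻¹`") and `n ≥ K a^{b/(1-2α)}` ((39)), with
`K ≥ √2G/(πT₀η)` and `K^{1-2α} ≥ 2√2G/η`. [cite: ColomboDelellisDerosa2018, §3.1 (proof of Lemma 3.1, "Proof of (31)", (38)–(39))] -/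
theorem alg_stress_sup (hα : α < 1 / 2) (hη : 0 < η) (hT₀ : 0 < T₀) (hG : 0 < G) (hK : 1 ≤ K)
    (hK₁ : Real.sqrt 2 * G / (Real.pi * T₀ * η) ≤ K) (hK₄ : 2 * Real.sqrt 2 * G / η ≤ K ^ (1 - 2 * α))
    (ha : 1 ≤ a) (hE₁ : 1 ≤ E₁) (hnY : K * (a ^ b * E₁) ≤ n) (hnX : K * a ^ (b / (1 - 2 * α)) ≤ n) :
    Real.sqrt 2 * (G * E₁ / T₀ / (2 * Real.pi * n) + (2 * Real.pi * n) ^ (2 * α - 1) * G) ≤ η * a ^ (-b) := by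
  have ha0 : 0 < a := by linarith
  have hK0 : 0 < K := by linarith
  have hab : 0 < a ^ b := Real.rpow_pos_of_pos ha0 _
  have habi : a ^ (-b) = (a ^ b)⁻¹ := Real.rpow_neg ha0.le b
  have hY : 0 < K * (a ^ b * E₁) := by positivity
  have hn : 0 < n := lt_of_lt_of_le hY hnY
  -- first term
  have t1 : G * E₁ / T₀ / (2 * Real.pi * n) ≤ G / (2 * Real.pi * T₀ * K) * a ^ (-b) := by
    rw [habi, div_le_iff₀ (by positivity : (0:ℝ) < 2 * Real.pi * n)]
    calc G * E₁ / T₀ = G / (2 * Real.pi * T₀ * K) * (a ^ b)⁻¹ * (2 * Real.pi * (K * (a ^ b * E₁))) := by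
          field_simp
        _ ≤ G / (2 * Real.pi * T₀ * K) * (a ^ b)⁻¹ * (2 * Real.pi * n) := by gcongr
  have c1 : Real.sqrt 2 * (G / (2 * Real.pi * T₀ * K)) ≤ η / 2 := by
    rw [div_le_iff₀ (by positivity)] at hK₁
    rw [mul_div_assoc', div_le_div_iff₀ (by positivity) two_pos]
    nlinarith [Real.pi_pos, hT₀, hη]
  -- second term
  have t2 : (2 * Real.pi * n) ^ (2 * α - 1) * G ≤ η / (2 * Real.sqrt 2 * G) * a ^ (-b) * G := by
    refine mul_le_mul_of_nonneg_right ?_ hG.le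
    calc (2 * Real.pi * n) ^ (2 * α - 1) ≤ K ^ (2 * α - 1) * a ^ (-b) := rpow_freq_le hα ha hK hnX
      _ ≤ η / (2 * Real.sqrt 2 * G) * a ^ (-b) :=
          mul_le_mul_of_nonneg_right (rpow_const_le hG hη hK0 hK₄) (by positivity)
  have hs2 : 0 < Real.sqrt 2 := by positivity
  calc Real.sqrt 2 * (G * E₁ / T₀ / (2 * Real.pi * n) + (2 * Real.pi * n) ^ (2 * α - 1) * G)
      ≤ Real.sqrt 2 * (G / (2 * Real.pi * T₀ * K) * a ^ (-b) + η / (2 * Real.sqrt 2 * G) * a ^ (-b) * G) := by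
        gcongr
    _ = Real.sqrt 2 * (G / (2 * Real.pi * T₀ * K)) * a ^ (-b) + η / 2 * a ^ (-b) := by
        field_simp
    _ ≤ η / 2 * a ^ (-b) + η / 2 * a ^ (-b) := by gcongr
    _ = η * a ^ (-b) := by ring

/-- The three exponent margins of the proof of (32) ("(e:quattro)", p. 7): for `0 < α < 1/5`,
`b ≥ 1`, `c ≥ 5/2`, each of `2αb/(1-2α)`, `2α(b+1)`, `2α(cb-1/2)` is at most `(c-1)b - 1/3`.
[cite: ColomboDelellisDerosa2018, §3.1 (proof of Lemma 3.1, the three inequalities after (47))] -/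
theorem exponent_margins (hα0 : 0 < α) (hα : α < 1 / 5) (hb : 1 ≤ b) (hc : 5 / 2 ≤ c) :
    2 * α * b / (1 - 2 * α) + 1 / 3 ≤ (c - 1) * b ∧ 2 * α * (b + 1) + 1 / 3 ≤ (c - 1) * b ∧
      2 * α * (c * b - 1 / 2) + 1 / 3 ≤ (c - 1) * b := by
  have h1α : 0 < 1 - 2 * α := by linarith
  have hcb : 3 / 2 * b ≤ (c - 1) * b := by nlinarith
  refine ⟨?_, ?_, ?_⟩
  · have h : 2 * α * b / (1 - 2 * α) ≤ 2 / 3 * b := by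
      rw [div_le_iff₀ h1α]
      nlinarith [mul_nonneg (by linarith : (0:ℝ) ≤ b) (by linarith : (0:ℝ) ≤ 2 / 3 - 10 * α / 3)]
    linarith
  · nlinarith [mul_nonneg (by linarith : (0:ℝ) ≤ b) (by linarith : (0:ℝ) ≤ 1 / 5 - α)]
  · nlinarith [mul_nonneg (mul_nonneg (by linarith : (0:ℝ) ≤ c) (by linarith : (0:ℝ) ≤ b))
      (by linarith : (0:ℝ) ≤ 1 - 2 * α - 3 / 5), mul_nonneg (by linarith : (0:ℝ) ≤ c - 5 / 2) (by linarith : (0:ℝ) ≤ b)]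

/-- The power bound behind (32): with `n ≤ 2K(X + Y + Z)`, `E₁ ≤ a`, `Z ≤ a^{cb-1/2}`,
`n^{2α} ≤ 2K (a^{2αb/(1-2α)} + a^{2α(b+1)} + a^{2α(cb-1/2)})` (`0 < 2α ≤ 1`, `K ≥ 1`, `a ≥ 1`).
[cite: ColomboDelellisDerosa2018, §3.1 (proof of Lemma 3.1, "Proof of (32)", (43))] -/
theorem rpow_freq_le_sum (hα0 : 0 < α) (hα : α ≤ 1 / 2) (ha : 1 ≤ a) (hK : 1 ≤ K) (hE₁ : 0 ≤ E₁)
    (hE₁a : E₁ ≤ a) (hE₂ : 0 ≤ E₂) (hn : 0 ≤ n)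
    (hn2 : n ≤ 2 * (K * (a ^ (b / (1 - 2 * α)) + a ^ b * E₁ + E₂ * a ^ (-((c - 1) * b - 1 / 2)))))
    (hZ : E₂ * a ^ (-((c - 1) * b - 1 / 2)) ≤ a ^ (c * b - 1 / 2)) :
    n ^ (2 * α) ≤ 2 * K * (a ^ (2 * α * b / (1 - 2 * α)) + a ^ (2 * α * (b + 1)) + a ^ (2 * α * (c * b - 1 / 2))) := by
  have ha0 : 0 < a := by linarith
  set X : ℝ := a ^ (b / (1 - 2 * α)) with hX_def
  set Y : ℝ := a ^ b * E₁ with hY_def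
  set Z : ℝ := E₂ * a ^ (-((c - 1) * b - 1 / 2)) with hZ_def
  have hX0 : 0 ≤ X := Real.rpow_nonneg ha0.le _
  have hY0 : 0 ≤ Y := mul_nonneg (Real.rpow_nonneg ha0.le _) hE₁
  have hZ0 : 0 ≤ Z := mul_nonneg hE₂ (Real.rpow_nonneg ha0.le _)
  have h2α0 : 0 ≤ 2 * α := by linarith
  have h2α1 : 2 * α ≤ 1 := by linarith
  -- `n^{2α} ≤ (2K)^{2α} (X+Y+Z)^{2α} ≤ 2K (X^{2α} + Y^{2α} + Z^{2α})`
  have h1 : n ^ (2 * α) ≤ (2 * K) ^ (2 * α) * (X + Y + Z) ^ (2 * α) := by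
    rw [← Real.mul_rpow (by linarith) (by positivity)]
    exact Real.rpow_le_rpow hn (by linarith) h2α0
  have h2 : (2 * K) ^ (2 * α) ≤ 2 * K := Real.rpow_le_self_of_one_le (by linarith) h2α1
  have h3 : (X + Y + Z) ^ (2 * α) ≤ X ^ (2 * α) + Y ^ (2 * α) + Z ^ (2 * α) :=
    (rpow_add_le_add_rpow_real (add_nonneg hX0 hY0) hZ0 h2α0 h2α1).trans
      (add_le_add (rpow_add_le_add_rpow_real hX0 hY0 h2α0 h2α1) le_rfl)
  -- the three powers
  have hX : X ^ (2 * α) = a ^ (2 * α * b / (1 - 2 * α)) := by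
    rw [hX_def, ← Real.rpow_mul ha0.le]; congr 1; ring
  have hY : Y ^ (2 * α) ≤ a ^ (2 * α * (b + 1)) := by
    calc Y ^ (2 * α) ≤ (a ^ b * a) ^ (2 * α) := Real.rpow_le_rpow hY0 (by rw [hY_def]; gcongr) h2α0
      _ = a ^ (2 * α * (b + 1)) := by
          rw [← Real.rpow_add_one ha0.ne', ← Real.rpow_mul ha0.le]; congr 1; ring
  have hZ' : Z ^ (2 * α) ≤ a ^ (2 * α * (c * b - 1 / 2)) := by
    calc Z ^ (2 * α) ≤ (a ^ (c * b - 1 / 2)) ^ (2 * α) := Real.rpow_le_rpow hZ0 hZ h2α0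
      _ = a ^ (2 * α * (c * b - 1 / 2)) := by rw [← Real.rpow_mul ha0.le]; congr 1; ring
  have hsum0 : 0 ≤ X ^ (2 * α) + Y ^ (2 * α) + Z ^ (2 * α) := by positivity
  calc n ^ (2 * α) ≤ (2 * K) ^ (2 * α) * (X + Y + Z) ^ (2 * α) := h1
    _ ≤ 2 * K * (X ^ (2 * α) + Y ^ (2 * α) + Z ^ (2 * α)) := by
        refine mul_le_mul h2 h3 (by positivity) (by linarith)
    _ ≤ 2 * K * (a ^ (2 * α * b / (1 - 2 * α)) + a ^ (2 * α * (b + 1)) + a ^ (2 * α * (c * b - 1 / 2))) := by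
        rw [hX]; gcongr

/-- **(32): `‖R̊₀‖₁ ≤ Mδ₁λ₀`** in real-arithmetic form:
`2√2πn (GE₁/T₀/(2πn) + (2πn)^{2α-1}G) ≤ M a^{-b} λ₀` (`λ₀ ≥ a^{cb}`), under `C₀E₁ ≤ a` with
`C₀ ≥ 2√2G/(T₀M)` ((42)) and the power bound of `rpow_freq_le_sum` with `24√2πGK/M ≤ a^{1/3}`
((43) and the three inequalities after (47)). [cite: ColomboDelellisDerosa2018, §3.1 (proof of Lemma 3.1, "Proof of (32)", (42)–(43))] -/
theorem alg_stress_deriv (hα0 : 0 < α) (hα : α < 1 / 5) (hT₀ : 0 < T₀) (hG : 0 < G) (hK : 1 ≤ K)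
    (hM : 0 < M) (hC₀ : 1 ≤ C₀) (hC₁ : 2 * Real.sqrt 2 * G / (T₀ * M) ≤ C₀) (ha : 1 ≤ a) (hb : 1 ≤ b)
    (hc : 5 / 2 ≤ c) (hE₁ : 1 ≤ E₁) (hE₂ : 0 ≤ E₂) (haE₁ : C₀ * E₁ ≤ a)
    (hQ : 24 * Real.sqrt 2 * Real.pi * G * K / M ≤ a ^ (1 / 3 : ℝ)) (hn : 0 < n)
    (hn2 : n ≤ 2 * (K * (a ^ (b / (1 - 2 * α)) + a ^ b * E₁ + E₂ * a ^ (-((c - 1) * b - 1 / 2)))))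
    (hZ : E₂ * a ^ (-((c - 1) * b - 1 / 2)) ≤ a ^ (c * b - 1 / 2)) (hlam : a ^ (c * b) ≤ lam₀) :
    2 * Real.pi * n * Real.sqrt 2 * (G * E₁ / T₀ / (2 * Real.pi * n) + (2 * Real.pi * n) ^ (2 * α - 1) * G) ≤
      M * a ^ (-b) * lam₀ := by
  have ha0 : 0 < a := by linarith
  have h2πn : 0 < 2 * Real.pi * n := by positivity
  set P : ℝ := a ^ ((c - 1) * b) with hP_def
  have hP0 : 0 < P := Real.rpow_pos_of_pos ha0 _
  -- the right-hand side dominates `M P`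
  have hR : M * P ≤ M * a ^ (-b) * lam₀ := by
    have h1 : a ^ (-b) * a ^ (c * b) = P := by rw [← Real.rpow_add ha0]; congr 1; ring
    calc M * P = M * a ^ (-b) * a ^ (c * b) := by rw [← h1]; ring
      _ ≤ M * a ^ (-b) * lam₀ := by gcongr
  -- rewrite the left-hand side
  have hL : 2 * Real.pi * n * Real.sqrt 2 * (G * E₁ / T₀ / (2 * Real.pi * n) + (2 * Real.pi * n) ^ (2 * α - 1) * G) =
      Real.sqrt 2 * G * E₁ / T₀ + Real.sqrt 2 * G * (2 * Real.pi * n) ^ (2 * α) := by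
    have h : (2 * Real.pi * n) ^ (2 * α) = (2 * Real.pi * n) ^ (2 * α - 1) * (2 * Real.pi * n) := by
      rw [← Real.rpow_add_one h2πn.ne', sub_add_cancel]
    rw [h]
    field_simp
  rw [hL]
  -- part A
  have hE₁a : E₁ ≤ a / C₀ := by rw [le_div_iff₀ (by linarith)]; linarith
  have hE₁a' : E₁ ≤ a := hE₁a.trans (div_le_self ha0.le hC₀)
  have haP : a ≤ P := by
    have : (1 : ℝ) ≤ (c - 1) * b := by nlinarith
    calc a = a ^ (1 : ℝ) := (Real.rpow_one a).symm
      _ ≤ P := Real.rpow_le_rpow_of_exponent_le ha this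
  have hA : Real.sqrt 2 * G * E₁ / T₀ ≤ M / 2 * P := by
    have h1 : Real.sqrt 2 * G * E₁ / T₀ ≤ Real.sqrt 2 * G * (a / C₀) / T₀ := by gcongr
    have h2 : Real.sqrt 2 * G / (T₀ * C₀) ≤ M / 2 := by
      rw [div_le_iff₀ (by positivity)] at hC₁
      rw [div_le_div_iff₀ (by positivity) two_pos]
      nlinarith [mul_pos hT₀ hM]
    calc Real.sqrt 2 * G * E₁ / T₀ ≤ Real.sqrt 2 * G * (a / C₀) / T₀ := h1
      _ = Real.sqrt 2 * G / (T₀ * C₀) * a := by field_simp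
      _ ≤ M / 2 * a := mul_le_mul_of_nonneg_right h2 ha0.le
      _ ≤ M / 2 * P := by gcongr
  -- part B
  have h2π1 : (1 : ℝ) ≤ 2 * Real.pi := by linarith [Real.pi_gt_three]
  have hpow : (2 * Real.pi * n) ^ (2 * α) ≤ 2 * Real.pi * n ^ (2 * α) := by
    rw [Real.mul_rpow (by positivity) hn.le]
    refine mul_le_mul_of_nonneg_right ?_ (Real.rpow_nonneg hn.le _)
    calc (2 * Real.pi) ^ (2 * α) ≤ (2 * Real.pi) ^ (1 : ℝ) := Real.rpow_le_rpow_of_exponent_le h2π1 (by linarith)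
      _ = 2 * Real.pi := Real.rpow_one _
  have hsum := rpow_freq_le_sum hα0 (by linarith) ha hK (by linarith) hE₁a' hE₂ hn.le hn2 hZ
  obtain ⟨m₁, m₂, m₃⟩ := exponent_margins hα0 hα hb hc
  have hQ0 : 0 ≤ 24 * Real.sqrt 2 * Real.pi * G * K / M := by positivity
  have key : ∀ θ : ℝ, θ + 1 / 3 ≤ (c - 1) * b →
      4 * Real.sqrt 2 * Real.pi * G * K * a ^ θ ≤ M / 6 * P := by
    intro θ hθ
    have h1 : a ^ θ * a ^ (1 / 3 : ℝ) ≤ P := by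
      rw [← Real.rpow_add ha0]
      exact Real.rpow_le_rpow_of_exponent_le ha hθ
    have h2 : 24 * Real.sqrt 2 * Real.pi * G * K / M * a ^ θ ≤ a ^ (1 / 3 : ℝ) * a ^ θ :=
      mul_le_mul_of_nonneg_right hQ (Real.rpow_nonneg ha0.le _)
    calc 4 * Real.sqrt 2 * Real.pi * G * K * a ^ θ = M / 6 * (24 * Real.sqrt 2 * Real.pi * G * K / M * a ^ θ) := by
          field_simp
          ring
      _ ≤ M / 6 * (a ^ (1 / 3 : ℝ) * a ^ θ) := by gcongr
      _ = M / 6 * (a ^ θ * a ^ (1 / 3 : ℝ)) := by ring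
      _ ≤ M / 6 * P := by gcongr
  have k₁ := key _ m₁
  have k₂ := key _ m₂
  have k₃ := key _ m₃
  have hB : Real.sqrt 2 * G * (2 * Real.pi * n) ^ (2 * α) ≤ M / 2 * P := by
    calc Real.sqrt 2 * G * (2 * Real.pi * n) ^ (2 * α) ≤ Real.sqrt 2 * G * (2 * Real.pi * n ^ (2 * α)) := by gcongr
      _ ≤ Real.sqrt 2 * G * (2 * Real.pi * (2 * K * (a ^ (2 * α * b / (1 - 2 * α)) + a ^ (2 * α * (b + 1)) +
          a ^ (2 * α * (c * b - 1 / 2))))) := by gcongr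
      _ = 4 * Real.sqrt 2 * Real.pi * G * K * a ^ (2 * α * b / (1 - 2 * α)) +
          4 * Real.sqrt 2 * Real.pi * G * K * a ^ (2 * α * (b + 1)) +
          4 * Real.sqrt 2 * Real.pi * G * K * a ^ (2 * α * (c * b - 1 / 2)) := by ring
      _ ≤ M / 6 * P + M / 6 * P + M / 6 * P := add_le_add (add_le_add k₁ k₂) k₃
      _ = M / 2 * P := by ring
  linarith

end Algebra

section AlgebraTwo

variable {α a b c G K C₀ M η T₀ E₁ E₂ n lam₀ : ℝ}

/-- **(33): `‖∂ₜR̊₀ + v₀·∇R̊₀‖₀ ≤ δ₁δ₀^{1/2}λ₀`** in real-arithmetic form: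
`√2 (G(E₂ + 2E₁²)/T₀²/(2πn) + (2πn)^{2α-1} GE₁/T₀) ≤ a^{-b} a^{-1/2} λ₀` (`λ₀ ≥ a^{cb}`), under
the frequency conditions `n ≥ K a^bE₁`, `n ≥ K a^{b/(1-2α)}`, `n ≥ K E₂a^{-((c-1)b-1/2)}` with
`K ≥ 2√2G/(πT₀²)` ((44): "`λ̄ ≥ C₀‖e‖_{C²}(δ₁δ₀^{1/2}λ₀)⁻¹`"), and `C₀E₁ ≤ a` with
`C₀ ≥ 4√2G/(πT₀²)`, `C₀ ≥ 2√2G/T₀` ((45)). [cite: ColomboDelellisDerosa2018, §3.1 (proof of Lemma 3.1, "Proof of (33)", (44)–(45))] -/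
theorem alg_transport (hα : α < 1 / 2) (hT₀ : 0 < T₀) (hG : 0 < G) (hK : 1 ≤ K)
    (hK₂ : 2 * Real.sqrt 2 * G / (Real.pi * T₀ ^ 2) ≤ K) (hC₀ : 1 ≤ C₀)
    (hC₂ : 4 * Real.sqrt 2 * G / (Real.pi * T₀ ^ 2) ≤ C₀) (hC₃ : 2 * Real.sqrt 2 * G / T₀ ≤ C₀)
    (ha : 1 ≤ a) (hb : 1 ≤ b) (hc : 5 / 2 ≤ c) (hE₁ : 1 ≤ E₁) (hE₂ : 0 < E₂) (haE₁ : C₀ * E₁ ≤ a)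
    (hnY : K * (a ^ b * E₁) ≤ n) (hnX : K * a ^ (b / (1 - 2 * α)) ≤ n)
    (hnZ : K * (E₂ * a ^ (-((c - 1) * b - 1 / 2))) ≤ n) (hlam : a ^ (c * b) ≤ lam₀) :
    Real.sqrt 2 * (G * (E₂ + 2 * E₁ ^ 2) / T₀ ^ 2 / (2 * Real.pi * n) +
        (2 * Real.pi * n) ^ (2 * α - 1) * (G * E₁ / T₀)) ≤ a ^ (-b) * a ^ (-(1 / 2 : ℝ)) * lam₀ := by
  have ha0 : 0 < a := by linarith
  have hK0 : 0 < K := by linarith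
  have hab : 0 < a ^ b := Real.rpow_pos_of_pos ha0 _
  have hY : 0 < K * (a ^ b * E₁) := by positivity
  have hn : 0 < n := lt_of_lt_of_le hY hnY
  have h2πn : 0 < 2 * Real.pi * n := by positivity
  set q : ℝ := (c - 1) * b - 1 / 2 with hq_def
  set P : ℝ := a ^ q with hP_def
  have hP0 : 0 < P := Real.rpow_pos_of_pos ha0 _
  have hq1 : 1 ≤ q := by rw [hq_def]; nlinarith
  have haP : a ≤ P := by
    calc a = a ^ (1 : ℝ) := (Real.rpow_one a).symm
      _ ≤ P := Real.rpow_le_rpow_of_exponent_le ha hq1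
  have h1P : 1 ≤ P := ha.trans haP
  -- the right-hand side dominates `P`
  have hR : P ≤ a ^ (-b) * a ^ (-(1 / 2 : ℝ)) * lam₀ := by
    have h1 : a ^ (-b) * a ^ (-(1 / 2 : ℝ)) * a ^ (c * b) = P := by
      rw [← Real.rpow_add ha0, ← Real.rpow_add ha0]; congr 1; rw [hq_def]; ring
    rw [← h1]
    gcongr
  -- C1: the `E₂` part of the first term
  have haq : a ^ (-q) = P⁻¹ := Real.rpow_neg ha0.le q
  have hZpos : 0 < E₂ * a ^ (-q) := mul_pos hE₂ (Real.rpow_pos_of_pos ha0 _)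
  have c1 : Real.sqrt 2 * (G * E₂ / T₀ ^ 2 / (2 * Real.pi * n)) ≤ 1 / 4 * P := by
    have h1 : G * E₂ / T₀ ^ 2 / (2 * Real.pi * n) ≤ G * E₂ / T₀ ^ 2 / (2 * Real.pi * (K * (E₂ * a ^ (-q)))) := by
      gcongr
    have h2 : G * E₂ / T₀ ^ 2 / (2 * Real.pi * (K * (E₂ * a ^ (-q)))) = G / (2 * Real.pi * T₀ ^ 2 * K) * P := by
      rw [haq]
      field_simp
    have h3 : Real.sqrt 2 * (G / (2 * Real.pi * T₀ ^ 2 * K)) ≤ 1 / 4 := by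
      have : Real.sqrt 2 * (G / (2 * Real.pi * T₀ ^ 2 * K)) = 2 * Real.sqrt 2 * G / (Real.pi * T₀ ^ 2) / (4 * K) := by
        field_simp
        ring
      rw [this, div_le_iff₀ (by positivity)]
      linarith
    calc Real.sqrt 2 * (G * E₂ / T₀ ^ 2 / (2 * Real.pi * n))
        ≤ Real.sqrt 2 * (G / (2 * Real.pi * T₀ ^ 2 * K) * P) := by rw [← h2]; gcongr
      _ = Real.sqrt 2 * (G / (2 * Real.pi * T₀ ^ 2 * K)) * P := by ring
      _ ≤ 1 / 4 * P := mul_le_mul_of_nonneg_right h3 hP0.le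
  -- C2: the `E₁²` part of the first term
  have hE₁a : E₁ ≤ a / C₀ := by rw [le_div_iff₀ (by linarith)]; linarith
  have haab : a / a ^ b ≤ 1 := by
    rw [div_le_one hab]
    calc a = a ^ (1 : ℝ) := (Real.rpow_one a).symm
      _ ≤ a ^ b := Real.rpow_le_rpow_of_exponent_le ha hb
  have c2 : Real.sqrt 2 * (G * (2 * E₁ ^ 2) / T₀ ^ 2 / (2 * Real.pi * n)) ≤ 1 / 4 * P := by
    have h1 : G * (2 * E₁ ^ 2) / T₀ ^ 2 / (2 * Real.pi * n) ≤ G * (2 * E₁ ^ 2) / T₀ ^ 2 / (2 * Real.pi * (K * (a ^ b * E₁))) := by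
      gcongr
    have h2 : G * (2 * E₁ ^ 2) / T₀ ^ 2 / (2 * Real.pi * (K * (a ^ b * E₁))) = G / (Real.pi * T₀ ^ 2 * K) * (E₁ / a ^ b) := by
      field_simp
    have h3 : E₁ / a ^ b ≤ 1 / C₀ := by
      calc E₁ / a ^ b ≤ (a / C₀) / a ^ b := by gcongr
        _ = (a / a ^ b) / C₀ := by field_simp
        _ ≤ 1 / C₀ := by gcongr
    have h4 : Real.sqrt 2 * (G / (Real.pi * T₀ ^ 2 * K) * (1 / C₀)) ≤ 1 / 4 := by
      have e1 : Real.sqrt 2 * (G / (Real.pi * T₀ ^ 2 * K) * (1 / C₀)) =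
          (4 * Real.sqrt 2 * G / (Real.pi * T₀ ^ 2)) / (4 * C₀) / K := by
        field_simp
      have hfrac : (4 * Real.sqrt 2 * G / (Real.pi * T₀ ^ 2)) / (4 * C₀) ≤ 1 / 4 := by
        rw [div_le_iff₀ (by positivity)]
        linarith
      have hfrac0 : 0 ≤ (4 * Real.sqrt 2 * G / (Real.pi * T₀ ^ 2)) / (4 * C₀) := by positivity
      rw [e1]
      exact (div_le_self hfrac0 hK).trans hfrac
    calc Real.sqrt 2 * (G * (2 * E₁ ^ 2) / T₀ ^ 2 / (2 * Real.pi * n))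
        ≤ Real.sqrt 2 * (G / (Real.pi * T₀ ^ 2 * K) * (E₁ / a ^ b)) := by rw [← h2]; gcongr
      _ ≤ Real.sqrt 2 * (G / (Real.pi * T₀ ^ 2 * K) * (1 / C₀)) := by gcongr
      _ ≤ 1 / 4 := h4
      _ = 1 / 4 * 1 := by ring
      _ ≤ 1 / 4 * P := by gcongr
  -- C3: the second term
  have c3 : Real.sqrt 2 * ((2 * Real.pi * n) ^ (2 * α - 1) * (G * E₁ / T₀)) ≤ 1 / 2 * P := by
    have h1 : (2 * Real.pi * n) ^ (2 * α - 1) ≤ a ^ (-b) := by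
      calc (2 * Real.pi * n) ^ (2 * α - 1) ≤ K ^ (2 * α - 1) * a ^ (-b) := rpow_freq_le hα ha hK hnX
        _ ≤ 1 * a ^ (-b) := mul_le_mul_of_nonneg_right (rpow_const_le_one hK hα.le) (Real.rpow_nonneg ha0.le _)
        _ = a ^ (-b) := one_mul _
    have h2 : a ^ (-b) * (G * E₁ / T₀) ≤ G / (T₀ * C₀) := by
      rw [Real.rpow_neg ha0.le]
      calc (a ^ b)⁻¹ * (G * E₁ / T₀) ≤ (a ^ b)⁻¹ * (G * (a / C₀) / T₀) := by gcongr
        _ = G / (T₀ * C₀) * (a / a ^ b) := by field_simp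
        _ ≤ G / (T₀ * C₀) * 1 := by gcongr
        _ = G / (T₀ * C₀) := mul_one _
    have h3 : Real.sqrt 2 * (G / (T₀ * C₀)) ≤ 1 / 2 := by
      have : Real.sqrt 2 * (G / (T₀ * C₀)) = (2 * Real.sqrt 2 * G / T₀) / (2 * C₀) := by
        field_simp
      rw [this, div_le_iff₀ (by positivity)]
      linarith
    calc Real.sqrt 2 * ((2 * Real.pi * n) ^ (2 * α - 1) * (G * E₁ / T₀))
        ≤ Real.sqrt 2 * (a ^ (-b) * (G * E₁ / T₀)) := by gcongr
      _ ≤ Real.sqrt 2 * (G / (T₀ * C₀)) := by gcongr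
      _ ≤ 1 / 2 := h3
      _ = 1 / 2 * 1 := by ring
      _ ≤ 1 / 2 * P := by gcongr
  -- assemble
  have hsplit : Real.sqrt 2 * (G * (E₂ + 2 * E₁ ^ 2) / T₀ ^ 2 / (2 * Real.pi * n) +
      (2 * Real.pi * n) ^ (2 * α - 1) * (G * E₁ / T₀)) =
      Real.sqrt 2 * (G * E₂ / T₀ ^ 2 / (2 * Real.pi * n)) + Real.sqrt 2 * (G * (2 * E₁ ^ 2) / T₀ ^ 2 / (2 * Real.pi * n)) +
        Real.sqrt 2 * ((2 * Real.pi * n) ^ (2 * α - 1) * (G * E₁ / T₀)) := by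
    field_simp
  rw [hsplit]
  linarith

/-- **(38), first half: `[v₀]₁ ≤ C₀ max{a^{b/(1-2α)}, a^bE₁, E₂^{(cb-1/2)/((2c-1)b-1)}}`** in
real-arithmetic form: `2√2πGn ≤ C₀ max{…}` when `n ≤ 2K(X+Y+Z)`, `Z ≤ E₂^p` and `C₀ ≥ 12√2πGK`
("Conclusion", (47) and (50)). [cite: ColomboDelellisDerosa2018, §3.1 (proof of Lemma 3.1, "Conclusion", (47), (50))] -/
theorem alg_velocity_deriv (ha : 1 ≤ a) (hG : 0 < G) (hK : 1 ≤ K) (hE₁ : 0 ≤ E₁)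
    (hC₄ : 12 * Real.sqrt 2 * Real.pi * G * K ≤ C₀)
    (hn2 : n ≤ 2 * (K * (a ^ (b / (1 - 2 * α)) + a ^ b * E₁ + E₂ * a ^ (-((c - 1) * b - 1 / 2)))))
    (hZ : E₂ * a ^ (-((c - 1) * b - 1 / 2)) ≤ E₂ ^ ((c * b - 1 / 2) / ((2 * c - 1) * b - 1))) :
    2 * Real.pi * n * Real.sqrt 2 * G ≤
      C₀ * max (a ^ (b / (1 - 2 * α))) (max (a ^ b * E₁) (E₂ ^ ((c * b - 1 / 2) / ((2 * c - 1) * b - 1)))) := by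
  have ha0 : 0 < a := by linarith
  set X : ℝ := a ^ (b / (1 - 2 * α)) with hX_def
  set Y : ℝ := a ^ b * E₁ with hY_def
  set Z : ℝ := E₂ * a ^ (-((c - 1) * b - 1 / 2)) with hZ_def
  set W : ℝ := E₂ ^ ((c * b - 1 / 2) / ((2 * c - 1) * b - 1)) with hW_def
  set m : ℝ := max X (max Y W) with hm_def
  have hX0 : 0 ≤ X := Real.rpow_nonneg ha0.le _
  have hY0 : 0 ≤ Y := mul_nonneg (Real.rpow_nonneg ha0.le _) hE₁
  have hXm : X ≤ m := le_max_left _ _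
  have hYm : Y ≤ m := (le_max_left _ _).trans (le_max_right _ _)
  have hWm : W ≤ m := (le_max_right _ _).trans (le_max_right _ _)
  have hm0 : 0 ≤ m := hX0.trans hXm
  have hsum : X + Y + Z ≤ 3 * m := by linarith
  calc 2 * Real.pi * n * Real.sqrt 2 * G ≤ 2 * Real.pi * (2 * (K * (X + Y + Z))) * Real.sqrt 2 * G := by gcongr
    _ ≤ 2 * Real.pi * (2 * (K * (3 * m))) * Real.sqrt 2 * G := by gcongr
    _ = 12 * Real.sqrt 2 * Real.pi * G * K * m := by ring
    _ ≤ C₀ * m := mul_le_mul_of_nonneg_right hC₄ hm0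

/-- **(38), second half: `[v₀]₁ ≤ Mδ₀^{1/2}λ₀`** in real-arithmetic form:
`2√2πGn ≤ M a^{-1/2} λ₀` (`λ₀ ≥ a^{cb}`) when `n ≤ 2K(X+Y+Z)`, `Z ≤ a^{cb-1/2}/C₀`, `C₀E₁ ≤ a`,
`C₀ ≥ 12√2πGK/M` and `12√2πGK/M ≤ a^{1/3}` ("Conclusion", (46), (48)–(49)).
[cite: ColomboDelellisDerosa2018, §3.1 (proof of Lemma 3.1, "Conclusion", (46), (48)–(49))] -/
theorem alg_velocity_deriv' (hα : α ≤ 1 / 5) (ha : 1 ≤ a) (hb : 1 ≤ b) (hc : 5 / 2 ≤ c)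
    (hG : 0 < G) (hK : 1 ≤ K) (hM : 0 < M) (hC₀ : 1 ≤ C₀) (hE₁ : 0 ≤ E₁)
    (hC₅ : 12 * Real.sqrt 2 * Real.pi * G * K / M ≤ C₀) (haE₁ : C₀ * E₁ ≤ a)
    (hQ : 12 * Real.sqrt 2 * Real.pi * G * K / M ≤ a ^ (1 / 3 : ℝ))
    (hn2 : n ≤ 2 * (K * (a ^ (b / (1 - 2 * α)) + a ^ b * E₁ + E₂ * a ^ (-((c - 1) * b - 1 / 2)))))
    (hZ : E₂ * a ^ (-((c - 1) * b - 1 / 2)) ≤ a ^ (c * b - 1 / 2) / C₀) (hlam : a ^ (c * b) ≤ lam₀) :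
    2 * Real.pi * n * Real.sqrt 2 * G ≤ M * a ^ (-(1 / 2 : ℝ)) * lam₀ := by
  have ha0 : 0 < a := by linarith
  have hK0 : 0 < K := by linarith
  set X : ℝ := a ^ (b / (1 - 2 * α)) with hX_def
  set Y : ℝ := a ^ b * E₁ with hY_def
  set Z : ℝ := E₂ * a ^ (-((c - 1) * b - 1 / 2)) with hZ_def
  set P : ℝ := a ^ (c * b - 1 / 2) with hP_def
  have hP0 : 0 < P := Real.rpow_pos_of_pos ha0 _
  have hX0 : 0 ≤ X := Real.rpow_nonneg ha0.le _
  have hY0 : 0 ≤ Y := mul_nonneg (Real.rpow_nonneg ha0.le _) hE₁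
  -- the right-hand side dominates `M P`
  have hR : M * P ≤ M * a ^ (-(1 / 2 : ℝ)) * lam₀ := by
    have h1 : a ^ (-(1 / 2 : ℝ)) * a ^ (c * b) = P := by rw [← Real.rpow_add ha0]; congr 1; ring
    calc M * P = M * a ^ (-(1 / 2 : ℝ)) * a ^ (c * b) := by rw [← h1]; ring
      _ ≤ M * a ^ (-(1 / 2 : ℝ)) * lam₀ := by gcongr
  set L : ℝ := 4 * Real.sqrt 2 * Real.pi * G * K with hL_def
  have hL0 : 0 < L := by positivity
  have hLC : L ≤ M / 3 * C₀ := by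
    rw [div_le_iff₀ hM] at hC₅
    rw [hL_def]
    nlinarith
  have hLQ : 3 * L / M ≤ a ^ (1 / 3 : ℝ) := by
    have : 3 * L / M = 12 * Real.sqrt 2 * Real.pi * G * K / M := by rw [hL_def]; ring
    rw [this]; exact hQ
  -- X term: exponent margin `b/(1-2α) + 1/3 ≤ cb - 1/2`
  have hmargin : b / (1 - 2 * α) + 1 / 3 ≤ c * b - 1 / 2 := by
    have h1α : 0 < 1 - 2 * α := by linarith
    have h1 : b / (1 - 2 * α) ≤ 5 / 3 * b := by
      rw [div_le_iff₀ h1α]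
      nlinarith [mul_nonneg (by linarith : (0:ℝ) ≤ b) (by linarith : (0:ℝ) ≤ 2 / 3 - 10 * α / 3)]
    nlinarith [mul_nonneg (by linarith : (0:ℝ) ≤ c - 5 / 2) (by linarith : (0:ℝ) ≤ b)]
  have hXt : L * X ≤ M / 3 * P := by
    have h1 : X * a ^ (1 / 3 : ℝ) ≤ P := by
      rw [hX_def, ← Real.rpow_add ha0]
      exact Real.rpow_le_rpow_of_exponent_le ha hmargin
    have h2 : L * X = M / 3 * (3 * L / M * X) := by field_simp
    rw [h2]
    refine mul_le_mul_of_nonneg_left ?_ (by positivity)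
    calc 3 * L / M * X ≤ a ^ (1 / 3 : ℝ) * X := mul_le_mul_of_nonneg_right hLQ hX0
      _ = X * a ^ (1 / 3 : ℝ) := mul_comm _ _
      _ ≤ P := h1
  -- Y term: `a^b E₁ ≤ a^{b+1}/C₀ ≤ P/C₀`
  have hYt : L * Y ≤ M / 3 * P := by
    have hE₁a : E₁ ≤ a / C₀ := by rw [le_div_iff₀ (by linarith)]; linarith
    have h1 : Y ≤ P / C₀ := by
      have hb1 : a ^ b * a ≤ P := by
        rw [← Real.rpow_add_one ha0.ne']
        refine Real.rpow_le_rpow_of_exponent_le ha ?_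
        nlinarith
      calc Y ≤ a ^ b * (a / C₀) := by rw [hY_def]; gcongr
        _ = a ^ b * a / C₀ := by ring
        _ ≤ P / C₀ := by gcongr
    calc L * Y ≤ L * (P / C₀) := by gcongr
      _ = L / C₀ * P := by ring
      _ ≤ M / 3 * P := by
          refine mul_le_mul_of_nonneg_right ?_ hP0.le
          rw [div_le_iff₀ (by linarith)]
          exact hLC
  -- Z term
  have hZt : L * Z ≤ M / 3 * P := by
    calc L * Z ≤ L * (P / C₀) := by gcongr
      _ = L / C₀ * P := by ring
      _ ≤ M / 3 * P := by
          refine mul_le_mul_of_nonneg_right ?_ hP0.le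
          rw [div_le_iff₀ (by linarith)]
          exact hLC
  calc 2 * Real.pi * n * Real.sqrt 2 * G ≤ 2 * Real.pi * (2 * (K * (X + Y + Z))) * Real.sqrt 2 * G := by gcongr
    _ = L * X + L * Y + L * Z := by rw [hL_def]; ring
    _ ≤ M / 3 * P + M / 3 * P + M / 3 * P := add_le_add (add_le_add hXt hYt) hZt
    _ = M * P := by ring
    _ ≤ M * a ^ (-(1 / 2 : ℝ)) * lam₀ := hR

end AlgebraTwo

/-! ## Hypotheses of Lemma 3.1 (tree form) -/

section Hypotheses

/-- **The hypotheses of Lemma 3.1 on the constants and parameters**, in the universal form of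
§8.3: exponent `0 < α < 1/5`; window constants `0 < c₀ ≤ 1`, `T₀ > 0` (the tree's
normalisation, cf. `FractionalNSPrescribedEnergyIteration`); the constants `M ≥ 1`, `η > 0` of
the iteration ("Fix `M` and `η` positive constants"); parameters `c ≥ 5/2`, `b ≥ 1` and `a` with
`a ≥ a₀ = CDLDR.startThreshold`, `a ≥ C₀E₁`, `a ≥ C₀E₂^{1/((2c-1)b-1)}` for the family bounds
`1 ≤ E₁`, `1 ≤ E₂` ((41)/(81) with `C₀ = CDLDR.startDerivConst`).
[cite: ColomboDelellisDerosa2018, §3.1 Lemma 3.1 (36) and §3.2 Prop. 3.2 (41), §8.3 (81)] -/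
structure StartHyp (α c₀ T₀ M η a b c E₁ E₂ : ℝ) : Prop where
  /-- `0 < α`. -/
  α_pos : 0 < α
  /-- `α < 1/5`. -/
  α_lt : α < 1 / 5
  /-- `0 < c₀`. -/
  c₀_pos : 0 < c₀
  /-- `c₀ ≤ 1` (so that `‖v₀‖₀ ≤ √c₀ ≤ 1 ≤ M`, cf. "(37) is obvious since `‖v₀‖₀ ≤ 1` and `M ≥ 1`"). -/
  c₀_le_one : c₀ ≤ 1
  /-- `0 < T₀`. -/
  T₀_pos : 0 < T₀
  /-- `M ≥ 1`. -/
  one_le_M : 1 ≤ M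
  /-- `η > 0`. -/
  η_pos : 0 < η
  /-- `c ≥ 5/2`. -/
  c_ge : 5 / 2 ≤ c
  /-- `b ≥ 1`. -/
  b_ge : 1 ≤ b
  /-- `E₁ ≥ 1`. -/
  one_le_E₁ : 1 ≤ E₁
  /-- `E₂ ≥ 1`. -/
  one_le_E₂ : 1 ≤ E₂
  /-- `a ≥ a₀`. -/
  threshold_le : startThreshold α c₀ T₀ M η ≤ a
  /-- `a ≥ C₀ E₁`. -/
  E₁_le : startDerivConst α c₀ T₀ M η * E₁ ≤ a
  /-- `a ≥ C₀ E₂^{1/((2c-1)b-1)}`. -/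
  E₂_le : startDerivConst α c₀ T₀ M η * E₂ ^ (1 / ((2 * c - 1) * b - 1)) ≤ a

/-- **The hypotheses of Lemma 3.1 on one energy profile** (those of `IsEnergyProfileFamily`,
member by member): `e` smooth, `c₀/2 ≤ e ≤ c₀`, `|e'| ≤ c₀E₁/T₀`, `|e''| ≤ c₀E₂/T₀²` on `[0,T₀]`.
[cite: ColomboDelellisDerosa2018, §2 Prop. 2.2 (i), (iv), (v)] -/
structure StartProfile (c₀ T₀ E₁ E₂ : ℝ) (e : ℝ → ℝ) : Prop where
  /-- `e` is smooth on `ℝ`. -/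
  contDiff : ContDiff ℝ ∞ e
  /-- `c₀/2 ≤ e` on `[0,T₀]`. -/
  lower : ∀ t ∈ Icc 0 T₀, c₀ / 2 ≤ e t
  /-- `e ≤ c₀` on `[0,T₀]`. -/
  upper : ∀ t ∈ Icc 0 T₀, e t ≤ c₀
  /-- `|e'| ≤ c₀E₁/T₀` on `[0,T₀]`. -/
  abs_deriv_le : ∀ t ∈ Icc 0 T₀, |deriv e t| ≤ c₀ * E₁ / T₀
  /-- `|e''| ≤ c₀E₂/T₀²` on `[0,T₀]`. -/
  abs_iteratedDeriv_two_le : ∀ t ∈ Icc 0 T₀, |iteratedDeriv 2 e t| ≤ c₀ * E₂ / T₀ ^ 2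

/-- Every member of an admissible family of profiles satisfies the profile hypotheses of
Lemma 3.1. [folklore] -/
theorem _root_.Literature.Analysis.FluidPDE.IsEnergyProfileFamily.startProfile {c₀ T₀ E₁ E₂ : ℝ}
    {𝓔 : Set (ℝ → ℝ)} (h : IsEnergyProfileFamily c₀ T₀ E₁ E₂ 𝓔) {e : ℝ → ℝ} (he : e ∈ 𝓔) :
    StartProfile c₀ T₀ E₁ E₂ e where
  contDiff := h.contDiff e he
  lower := h.lower e he
  upper := h.upper e he
  abs_deriv_le := h.abs_deriv_le e he
  abs_iteratedDeriv_two_le := h.abs_iteratedDeriv_two_le e he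

/-- The hypothesis structure is inhabited: e.g. `α = 1/10`, `c₀ = T₀ = M = η = 1`, `c = 5/2`,
`b = 1`, `E₁ = E₂ = 1` and `a` the maximum of the three thresholds. [folklore] -/
theorem startHyp_example :
    StartHyp (1 / 10) 1 1 1 1
      (max (startThreshold (1 / 10) 1 1 1 1) (startDerivConst (1 / 10) 1 1 1 1)) 1 (5 / 2) 1 1 where
  α_pos := by norm_num
  α_lt := by norm_num
  c₀_pos := one_pos
  c₀_le_one := le_rfl
  T₀_pos := one_pos
  one_le_M := le_rfl
  η_pos := one_pos
  c_ge := le_rfl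
  b_ge := le_rfl
  one_le_E₁ := le_rfl
  one_le_E₂ := le_rfl
  threshold_le := le_max_left _ _
  E₁_le := by rw [mul_one]; exact le_max_right _ _
  E₂_le := by rw [Real.one_rpow, mul_one]; exact le_max_right _ _

end Hypotheses

/-! ## Lemma 3.1 -/

section Main

variable {α c₀ T₀ M η a b c E₁ E₂ : ℝ} {e : ℝ → ℝ}

/-- The amplitude `δ₁ = a^{-b}` and `δ₀^{1/2} = a^{-1/2}`. [folklore] -/
theorem amp_one_eq (a b : ℝ) : amp a b 1 = a ^ (-b) := by rw [amp_def, pow_one]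

/-- `δ₀^{1/2} = a^{-1/2}` for `a ≥ 0`. [folklore] -/
theorem sqrt_amp_zero_eq {a : ℝ} (ha : 0 ≤ a) (b : ℝ) : Real.sqrt (amp a b 0) = a ^ (-(1 / 2 : ℝ)) := by
  rw [amp_def, pow_zero, Real.sqrt_eq_rpow, ← Real.rpow_mul ha]
  norm_num

/-- **Colombo–De Lellis–De Rosa 2018, Lemma 3.1 (the starting triple and its estimates)**, in
the tree's normalisation and in the universal form of §8.3. Printed: "Fix `M` and `η` positive
constants and let `α ∈ ]0, 1/5[`. If `a, b` and `c` satisfy `c > 5/2`, `b > 1`,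
`a^{(c-1)b-1/2} ≥ C₀‖e‖_{C¹}` and `a^{(2c-1)b-1} ≥ C₀‖e‖_{C²}` (where `C₀` is a suitable geometric
constant, depending only upon `M` and `η`), then there is a triple `(v₀, p₀, R̊₀)` satisfying
(26), (31), (32), (33) and (37) `‖v₀‖₀ ≤ M`,
(38) `‖v₀‖₁ ≤ min{C₀ max{a^{b/(1-2α)}, a^b‖e‖_{C¹}, ‖e‖_{C²}^{(cb-1/2)/((2c-1)b-1)}}, Mδ₀^{1/2}λ₀}`,
(39) `‖p₀‖₀ ≤ M²`, (40) `‖p₀‖₁ ≤ M²δ₀λ₀²`", with (31) `‖R̊₀‖₀ ≤ ηδ₁`, (32) `‖R̊₀‖₁ ≤ Mδ₁λ₀`,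
(33) `‖∂ₜR̊₀ + v₀·∇R̊₀‖₀ ≤ δ₁δ₀^{1/2}λ₀`, `δ_q = a^{-b^q}`, `λ₀ ∈ [a^{cb}, 2a^{cb}]`; and (§8.3) with
`‖e‖_{C¹}, ‖e‖_{C²}` replaced by `E₁, E₂` and `λ̄` as in (82), common to the family.

Tree form: under `CDLDR.StartHyp α c₀ T₀ M η a b c E₁ E₂` (constants `C₀ = startDerivConst`,
`a₀ = startThreshold` explicit in `α, c₀, T₀, M, η`), for every `λ₀ ≥ a^{cb}` and every profile
`e` with `CDLDR.StartProfile c₀ T₀ E₁ E₂ e`, the explicit triple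
`v₀ = shearVelocity n (startAmp e δ₁)`, `p₀ = 0`, `R̊₀ = shearStress α n (startAmp e δ₁)` with the
profile-independent frequency `n = startFreq α c₀ T₀ η a b c E₁ E₂ ≥ 1` and `δ₁ = CDLDR.amp a b 1`
satisfies: (26) `Torus.IsFracNSReynoldsOn (Icc 0 T₀) α 1`; (31) `BDSV.SupLE T₀ R̊₀ (ηδ₁)`;
(32) `BDSV.DerivSupLE T₀ R̊₀ (Mδ₁λ₀)`; (33) `‖∂ₜR̊₀ + (v₀·∇)R̊₀‖ ≤ δ₁δ₀^{1/2}λ₀` on `[0,T₀] × 𝕋³`;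
(37) `BDSV.SupLE T₀ v₀ M`; (38) `BDSV.DerivSupLE T₀ v₀ (C₀ max{a^{b/(1-2α)}, a^bE₁, E₂^{(cb-1/2)/((2c-1)b-1)}})`
and `BDSV.DerivSupLE T₀ v₀ (Mδ₀^{1/2}λ₀)`; and the exact energy `∫‖v₀(t)‖² = e(t)(1-δ₁)`
(so (35) at `q = 0`). The pressure is `0`, so (39)–(40) are empty; the common initial slice is
`shearVelocity_startAmp_zero_eq`. [cite: ColomboDelellisDerosa2018, §3.1 Lemma 3.1 with (36)–(51) (pp. 6–7); §8.3 (81)–(82) (p. 19)] -/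
theorem _root_.Literature.Analysis.FluidPDE.ColomboDeLellisDeRosa2018_lem31 (H : StartHyp α c₀ T₀ M η a b c E₁ E₂) {lam₀ : ℝ}
    (hlam : a ^ (c * b) ≤ lam₀) (P : StartProfile c₀ T₀ E₁ E₂ e) :
    1 ≤ startFreq α c₀ T₀ η a b c E₁ E₂ ∧
    Torus.IsFracNSReynoldsOn (Icc 0 T₀) α 1
      (shearVelocity (startFreq α c₀ T₀ η a b c E₁ E₂) (startAmp e (amp a b 1))) (fun _ _ => 0)
      (shearStress α (startFreq α c₀ T₀ η a b c E₁ E₂) (startAmp e (amp a b 1))) ∧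
    BDSV.SupLE T₀ (shearStress α (startFreq α c₀ T₀ η a b c E₁ E₂) (startAmp e (amp a b 1))) (η * amp a b 1) ∧
    BDSV.DerivSupLE T₀ (shearStress α (startFreq α c₀ T₀ η a b c E₁ E₂) (startAmp e (amp a b 1)))
      (M * amp a b 1 * lam₀) ∧
    (∀ t ∈ Icc 0 T₀, ∀ y,
      ‖FunctionSpaces.Torus.timeDerivWithin (Icc 0 T₀)
          (shearStress α (startFreq α c₀ T₀ η a b c E₁ E₂) (startAmp e (amp a b 1))) t y +
        FunctionSpaces.Torus.convect (shearVelocity (startFreq α c₀ T₀ η a b c E₁ E₂) (startAmp e (amp a b 1)) t)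
          (shearStress α (startFreq α c₀ T₀ η a b c E₁ E₂) (startAmp e (amp a b 1)) t) y‖ ≤
        amp a b 1 * Real.sqrt (amp a b 0) * lam₀) ∧
    BDSV.SupLE T₀ (shearVelocity (startFreq α c₀ T₀ η a b c E₁ E₂) (startAmp e (amp a b 1))) M ∧
    BDSV.DerivSupLE T₀ (shearVelocity (startFreq α c₀ T₀ η a b c E₁ E₂) (startAmp e (amp a b 1)))
      (startDerivConst α c₀ T₀ M η *
        max (a ^ (b / (1 - 2 * α))) (max (a ^ b * E₁) (E₂ ^ ((c * b - 1 / 2) / ((2 * c - 1) * b - 1))))) ∧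
    BDSV.DerivSupLE T₀ (shearVelocity (startFreq α c₀ T₀ η a b c E₁ E₂) (startAmp e (amp a b 1)))
      (M * Real.sqrt (amp a b 0) * lam₀) ∧
    (∀ t ∈ Icc 0 T₀, ∫ y, ‖shearVelocity (startFreq α c₀ T₀ η a b c E₁ E₂) (startAmp e (amp a b 1)) t y‖ ^ 2 =
      e t * (1 - amp a b 1)) := by
  -- constants
  set G : ℝ := Real.sqrt c₀ with hG_def
  set K : ℝ := startFreqConst α c₀ T₀ η with hK_def
  set C₀ : ℝ := startDerivConst α c₀ T₀ M η with hC₀_def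
  set n : ℕ := startFreq α c₀ T₀ η a b c E₁ E₂ with hn_def
  set δ₁ : ℝ := amp a b 1 with hδ₁_def
  have hα2 : α < 1 / 2 := by linarith [H.α_lt]
  have hM0 : 0 < M := by linarith [H.one_le_M]
  have hG0 : 0 < G := Real.sqrt_pos.2 H.c₀_pos
  have hG1 : G ≤ 1 := Real.sqrt_le_one.mpr H.c₀_le_one |>.trans_eq' rfl
  have hK1 : 1 ≤ K := one_le_startFreqConst H.T₀_pos H.η_pos
  have hK₁ : Real.sqrt 2 * G / (Real.pi * T₀ * η) ≤ K := startFreqConst_ge₁ H.T₀_pos H.η_pos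
  have hK₂ : 2 * Real.sqrt 2 * G / (Real.pi * T₀ ^ 2) ≤ K := startFreqConst_ge₂ H.T₀_pos H.η_pos
  have hK₄ : 2 * Real.sqrt 2 * G / η ≤ K ^ (1 - 2 * α) := startFreqConst_rpow_ge hα2 H.T₀_pos H.η_pos
  have hC₀1 : 1 ≤ C₀ := one_le_startDerivConst H.T₀_pos hM0 H.η_pos
  obtain ⟨hC₁, hC₂, hC₃, hC₄, hC₅⟩ := startDerivConst_ge (α := α) (c₀ := c₀) H.T₀_pos hM0 H.η_pos
  obtain ⟨ha2, hQ⟩ := startThreshold_spec H.T₀_pos hM0 H.η_pos H.threshold_le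
  have ha1 : 1 ≤ a := by linarith
  have ha0 : 0 < a := by linarith
  have hQ24 : 24 * Real.sqrt 2 * Real.pi * G * K / M ≤ a ^ (1 / 3 : ℝ) := by linarith
  have hQ12 : 12 * Real.sqrt 2 * Real.pi * G * K / M ≤ a ^ (1 / 3 : ℝ) := by
    have e : 12 * Real.sqrt 2 * Real.pi * G * K / M = (24 * Real.sqrt 2 * Real.pi * G * K / M) / 2 := by ring
    have h0 : 0 ≤ 24 * Real.sqrt 2 * Real.pi * G * K / M := by positivity
    rw [e]
    linarith
  have hb0 : 0 ≤ b := by linarith [H.b_ge]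
  have hE₁0 : 0 ≤ E₁ := by linarith [H.one_le_E₁]
  have hE₂0 : 0 < E₂ := by linarith [H.one_le_E₂]
  have hr : 1 ≤ (2 * c - 1) * b - 1 := by nlinarith [H.c_ge, H.b_ge]
  obtain ⟨hE₂a, hCE₂a⟩ := E₂_le_rpow hC₀1 hE₂0.le hr H.E₂_le
  have hZC : E₂ * a ^ (-((c - 1) * b - 1 / 2)) ≤ a ^ (c * b - 1 / 2) / C₀ :=
    E₂_mul_rpow_neg_le ha0 (by linarith) hCE₂a
  have hZ : E₂ * a ^ (-((c - 1) * b - 1 / 2)) ≤ a ^ (c * b - 1 / 2) :=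
    hZC.trans (div_le_self (Real.rpow_nonneg ha0.le _) hC₀1)
  have hZp : E₂ * a ^ (-((c - 1) * b - 1 / 2)) ≤ E₂ ^ ((c * b - 1 / 2) / ((2 * c - 1) * b - 1)) :=
    E₂_mul_rpow_neg_le_rpow ha1 hE₂0 H.b_ge (by linarith [H.c_ge]) hE₂a
  -- the frequency
  have hn1 : 1 ≤ n := one_le_startFreq hα2 H.T₀_pos H.η_pos ha1 hb0 hE₁0 hE₂0.le
  have hnpos : (0 : ℝ) < n := by exact_mod_cast hn1
  obtain ⟨hnX, hnY, hnZ⟩ := startFreq_ge (c := c) hα2 H.T₀_pos H.η_pos ha1 hb0 hE₁0 hE₂0.le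
  have hn2 : (n : ℝ) ≤ 2 * (K * (a ^ (b / (1 - 2 * α)) + a ^ b * E₁ + E₂ * a ^ (-((c - 1) * b - 1 / 2)))) :=
    startFreq_le_two_mul hα2 H.T₀_pos H.η_pos ha1 hb0 hE₁0 hE₂0.le
  -- `δ₁ = a^{-b} ∈ (0, 1/2]`, `δ₀^{1/2} = a^{-1/2}`
  have hδ₁ : δ₁ = a ^ (-b) := amp_one_eq a b
  have hδ₁0 : 0 < δ₁ := by rw [hδ₁]; exact Real.rpow_pos_of_pos ha0 _
  have hδ₁2 : δ₁ ≤ 1 / 2 := by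
    rw [hδ₁]
    calc a ^ (-b) ≤ a ^ (-(1 : ℝ)) := Real.rpow_le_rpow_of_exponent_le ha1 (by linarith [H.b_ge])
      _ = a⁻¹ := Real.rpow_neg_one a
      _ ≤ 1 / 2 := by rw [inv_eq_one_div, div_le_div_iff₀ ha0 two_pos]; linarith
  have hδ₀ : Real.sqrt (amp a b 0) = a ^ (-(1 / 2 : ℝ)) := sqrt_amp_zero_eq ha0.le b
  -- the amplitude
  set g : ℝ → ℝ := startAmp e δ₁ with hg_def
  set V : Set ℝ := e ⁻¹' Ioi (c₀ / 4) with hV_def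
  have hV : IsOpen V := isOpen_preimage_Ioi P.contDiff.continuous _
  have hSV : Icc 0 T₀ ⊆ V := Icc_subset_preimage_Ioi H.c₀_pos P.lower
  have hS : UniqueDiffOn ℝ (Icc 0 T₀) := uniqueDiffOn_Icc H.T₀_pos
  have hg : ContDiffOn ℝ ∞ g V := contDiffOn_startAmp P.contDiff (by linarith) H.c₀_pos.le
  have he1 : Differentiable ℝ e := P.contDiff.differentiable (by simp)
  have he2 : Differentiable ℝ (deriv e) := by
    have h := (P.contDiff.iterate_deriv 1).differentiable (by simp)
    simpa using h
  have hgt : ∀ t ∈ Icc 0 T₀, |g t| ≤ G := fun t ht => by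
    rw [abs_of_nonneg (startAmp_nonneg e δ₁ t)]
    exact startAmp_le_sqrt hδ₁0.le (by linarith [P.lower t ht, H.c₀_pos]) (P.upper t ht)
  have hg't : ∀ t ∈ Icc 0 T₀, |deriv g t| ≤ G * E₁ / T₀ := fun t ht =>
    abs_deriv_startAmp_le he1 hδ₁0.le hδ₁2 H.c₀_pos H.T₀_pos (P.lower t ht) (P.abs_deriv_le t ht)
  have hg''t : ∀ t ∈ Icc 0 T₀, |deriv (deriv g) t| ≤ G * (E₂ + 2 * E₁ ^ 2) / T₀ ^ 2 := fun t ht => by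
    have h2 : |deriv (deriv e) t| ≤ c₀ * E₂ / T₀ ^ 2 := by
      have h := P.abs_iteratedDeriv_two_le t ht
      rwa [show (2 : ℕ) = 1 + 1 from rfl, iteratedDeriv_succ, iteratedDeriv_one] at h
    exact abs_deriv_deriv_startAmp_le he1 he2 hδ₁0.le hδ₁2 H.c₀_pos H.T₀_pos (P.lower t ht)
      (P.abs_deriv_le t ht) h2
  have h2πn : 0 < 2 * Real.pi * (n : ℝ) := by positivity
  have hcoef : ∀ t ∈ Icc 0 T₀, |shearCoef α n g t| ≤
      G * E₁ / T₀ / (2 * Real.pi * n) + (2 * Real.pi * n) ^ (2 * α - 1) * G := fun t ht => by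
    refine (abs_shearCoef_le α hn1 g t).trans ?_
    gcongr
    · exact hg't t ht
    · exact hgt t ht
  have hcoef' : ∀ t ∈ Icc 0 T₀, |deriv (shearCoef α n g) t| ≤
      G * (E₂ + 2 * E₁ ^ 2) / T₀ ^ 2 / (2 * Real.pi * n) + (2 * Real.pi * n) ^ (2 * α - 1) * (G * E₁ / T₀) :=
    fun t ht => by
    refine (abs_deriv_shearCoef_le hn1 hV hg (hSV ht)).trans ?_
    gcongr
    · exact hg''t t ht
    · exact hg't t ht
  refine ⟨hn1, isFracNSReynoldsOn_shear α hn1 hV hSV hS hg, ?_, ?_, ?_, ?_, ?_, ?_, ?_⟩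
  -- (31)
  · intro t ht y
    calc ‖shearStress α n g t y‖ ≤ Real.sqrt 2 * |shearCoef α n g t| := norm_shearStress_le α n g t y
      _ ≤ Real.sqrt 2 * (G * E₁ / T₀ / (2 * Real.pi * n) + (2 * Real.pi * n) ^ (2 * α - 1) * G) := by
          gcongr; exact hcoef t ht
      _ ≤ η * a ^ (-b) := alg_stress_sup hα2 H.η_pos H.T₀_pos hG0 hK1 hK₁ hK₄ ha1 H.one_le_E₁ hnY hnX
      _ = η * δ₁ := by rw [hδ₁]
  -- (32)
  · intro i t ht y
    calc ‖FunctionSpaces.Torus.partialDeriv i (shearStress α n g t) y‖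
        ≤ 2 * Real.pi * n * Real.sqrt 2 * |shearCoef α n g t| := norm_partialDeriv_shearStress_le α n g i t y
      _ ≤ 2 * Real.pi * n * Real.sqrt 2 * (G * E₁ / T₀ / (2 * Real.pi * n) + (2 * Real.pi * n) ^ (2 * α - 1) * G) := by
          gcongr; exact hcoef t ht
      _ ≤ M * a ^ (-b) * lam₀ := alg_stress_deriv H.α_pos H.α_lt H.T₀_pos hG0 hK1 hM0 hC₀1 hC₁ ha1 H.b_ge
          H.c_ge H.one_le_E₁ hE₂0.le H.E₁_le hQ24 hnpos hn2 hZ hlam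
      _ = M * δ₁ * lam₀ := by rw [hδ₁]
  -- (33)
  · intro t ht y
    calc ‖FunctionSpaces.Torus.timeDerivWithin (Icc 0 T₀) (shearStress α n g) t y +
          FunctionSpaces.Torus.convect (shearVelocity n g t) (shearStress α n g t) y‖
        ≤ Real.sqrt 2 * |deriv (shearCoef α n g) t| := norm_transport_shearStress_le hV hSV hS hg ht y
      _ ≤ Real.sqrt 2 * (G * (E₂ + 2 * E₁ ^ 2) / T₀ ^ 2 / (2 * Real.pi * n) +
          (2 * Real.pi * n) ^ (2 * α - 1) * (G * E₁ / T₀)) := by gcongr; exact hcoef' t ht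
      _ ≤ a ^ (-b) * a ^ (-(1 / 2 : ℝ)) * lam₀ := alg_transport hα2 H.T₀_pos hG0 hK1 hK₂ hC₀1 hC₂ hC₃ ha1 H.b_ge
          H.c_ge H.one_le_E₁ hE₂0 H.E₁_le hnY hnX hnZ hlam
      _ = δ₁ * Real.sqrt (amp a b 0) * lam₀ := by rw [hδ₁, hδ₀]
  -- (37)
  · intro t ht y
    rw [norm_shearVelocity]
    exact (hgt t ht).trans (hG1.trans H.one_le_M)
  -- (38), first half
  · intro i t ht y
    calc ‖FunctionSpaces.Torus.partialDeriv i (shearVelocity n g t) y‖ ≤ 2 * Real.pi * n * Real.sqrt 2 * |g t| :=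
          norm_partialDeriv_shearVelocity_le n g i t y
      _ ≤ 2 * Real.pi * n * Real.sqrt 2 * G := by gcongr; exact hgt t ht
      _ ≤ C₀ * max (a ^ (b / (1 - 2 * α))) (max (a ^ b * E₁) (E₂ ^ ((c * b - 1 / 2) / ((2 * c - 1) * b - 1)))) :=
          alg_velocity_deriv ha1 hG0 hK1 hE₁0 hC₄ hn2 hZp
  -- (38), second half
  · intro i t ht y
    calc ‖FunctionSpaces.Torus.partialDeriv i (shearVelocity n g t) y‖ ≤ 2 * Real.pi * n * Real.sqrt 2 * |g t| :=
          norm_partialDeriv_shearVelocity_le n g i t y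
      _ ≤ 2 * Real.pi * n * Real.sqrt 2 * G := by gcongr; exact hgt t ht
      _ ≤ M * a ^ (-(1 / 2 : ℝ)) * lam₀ := alg_velocity_deriv' H.α_lt.le ha1 H.b_ge H.c_ge hG0 hK1 hM0 hC₀1 hE₁0
          hC₅ H.E₁_le hQ12 hn2 hZC hlam
      _ = M * Real.sqrt (amp a b 0) * lam₀ := by rw [hδ₀]
  -- (35)
  · intro t ht
    rw [integral_norm_sq_shearVelocity_startAmp (by linarith) (by linarith [P.lower t ht, H.c₀_pos]), mul_comm]

end Main

end CDLDR

end Literature.Analysis.FluidPDE
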